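import Summits.Langlands.Langlands.Theses.TorsionAvatarReduction
import Summits.Langlands.Langlands.Theorems.LevelOneDyadicTorsion
import Summits.Langlands.Langlands.Theorems.LevelOneDyadicFiniteLevelEngine

/-!
# Level-one dyadic reciprocity — part 14 «FiniteLevel»: TA 28545 ⟺ its FINITE-LEVEL form (proved engine) ⟺ defect-zero ∧ positive-defect torsion lifting, EXACTLY

Decomposition node `FiniteLevelTorsionSplit` of the Langlands root ladder (cell decomp-langlands, lens 4 «minimal counterexample / extremal reduction», gen 18;
RESIDUAL MODE, engine first — critic rule u1: «the next hop below the torsion dial needs an ENGINE LANDING or an instrument verdict, not a sixth dial»).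
TARGET = TA `Summit.Langlands.Langlands.Theses.TorsionAvatarReduction.TorsionAvatarAutomorphy` (stmt-Langlands-28545, crux r3 of route-Langlands-TorsionAvatarReduction
rev 0 — the lens-4 g17 child of RegularAvatarReduction at REG 28274): an irreducible, pinned-geometric, Hodge–Tate-regular level-one ρ : Γ_K → GL_n(ℚ̄₂) with insoluble
non-Artin residues, some reduction of which is associated with a CONTINUOUS 𝔽̄₂-point of Scholze's completed-cohomology Hecke algebra 𝕋(K^{(2)}) at full tame level
(ρ HAS A TORSION AVATAR), is residually automorphic.  The born decls TA / AL / FRAME⁗ are used BY NAME (their tree twins in `Theorems/LevelOneDyadicTorsion.lean` have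
the same text: `*_route_iff_twin`, `Iff.rfl`).

## The engine (§ENGINE; census cut = `Theorems/LevelOneDyadicFiniteLevelEngine.lean`)
Hypothesis-free LEVELWISE FACTORISATION (`exists_levelwise`): for any tame level 𝒰 and any DISCRETE field k, a continuous ring homomorphism ψ : 𝕋(𝒰) → k factors as
ψ = ψ' ∘ toLevel idx through the Hecke algebra `levelHeckeSubring idx` of ONE finite level idx = (r, s, i) — open kernel in the product of discrete finite-level rings
(`exists_finset_vanishing`), the DOMAIN TRICK shrinking the finite index set to one index (`exists_mem_forall_map_eq_zero`), descent along the surjective continuous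
level projection (`toLevel`, `toLevel_surjective`, `toLevel_heckeT`).  Corollary `isPadicallyAutomorphic_iff_levelwise`: p-adically automorphic with discrete
coefficients ⟺ associated (`IsAssociatedFamily`) with an eigensystem of one finite level on the `levelHeckeT`.  Printed shadow: Gee–Newton 2020 Lemma 2.1.8
(𝕋(K^p) semilocal; maximal ideals at one finite level, U_p pro-p).  No commutativity, no algebraic closedness used.

## The pieces (filed texts = the child route's items, verbatim)
* LA `LevelAvatarAutomorphy` (node-only): TA with the dial replaced by its finite-level form «∃ (r,s,i) τ ψ, ρ.IsReductionOf id ↑τ ∧ IsAssociatedFamily n (full n K 2).bad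
  (fun v j => ψ (levelHeckeT (r,s,i) v j)) τ» (`HasLevelAvatar`; `letI := ⊥` on 𝔽̄₂ as in TA's dial).  KERNEL 0/I: TA ⟺ LA (`ta_iff_levelAvatar`, THE ONE EQUIV, both
  directions by the engine; no junk: every ρ has a reduction, `Torsion.exists_isReductionOf`).
* TZ `DefectZeroTorsionAutomorphy` (crux r3, attacked): LA under the Calegari–Geraghty DEFECT-ZERO side condition `n = 2 ∧ NumberField.IsTotallyReal K` (on the box
  l₀(Res_{K/ℚ} GL_n) = 0 iff n = 2 ∧ K totally real; n = 1 is excluded by insolubility): a finite-level mod-2^s HILBERT eigenclass with insoluble non-Artin residue and an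
  HT-regular level-one lift ρ is congruent to a cusp form.  Line (KERNEL III `defectZero_of_classicalAvatar`, skeleton `Lines/classical-avatar.lean`): CLASSICAL AVATAR
  (dyadic torsion vanishing at generic non-Eisenstein 𝔪 — Caraiani–Tamiozzo 2023 is ℓ > 2: the DYADIC GAP — + tree-PROVED Deligne–Serre `Literature.Algebra.Module.
  deligneSerre_lifting_of_free` + cuspidality) then 2-ADIC AUTOMORPHY LIFTING over totally real K (Kisin 2009 et seq.); both stubs S-implied (`lineStubs_of_langlands`).
  RUNG `rung_of_defectZero`: DEPTH r = 0 (level-one Hilbert classes over totally real K; over ℚ the box is empty by Tate 1994).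
* TP `PositiveDefectTorsionAutomorphy` (crux r2, DECLARED RESIDUAL): LA under ¬(n = 2 ∧ K totally real) — Bianchi and beyond, GL_n≥3: torsion need not lift
  (Calegari–Venkatesh), the only engine is Calegari–Geraghty patching of complexes at ℓ = 2 (conditional), and for K neither CM nor totally real torsion classes have no
  Galois representations at all.  Birth (KERNEL III `positiveDefect_of_padicAutomorphy`, `Lines/birth.lean`): PA «ρ itself is 2-adically automorphic of full tame level»
  (tree `TameLevel.IsPadicallyAutomorphic ρ`; NOT S-implied — the honest load-bearing stub) then CLS (classicality up to congruence; S-implied).  RUNG `rung_of_positiveDefect`: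
  n = 2, K imaginary quadratic (Bianchi, l₀ = 1).  Inside TaylorWilesNumericalCoincidence / PatchingLocalComponentBarrier — declared.
* FL `FiniteLevelNormalForm` (support r9): TA's dial ⇒ LA's dial for every K, n, ρ — PROVED here (`finiteLevelNormalForm_holds`).
* FRAME⁵ `TorsionAvatarFrame` (support r9) := `TorsionAvatarReduction.TorsionAvatarAutomorphy → Langlands` — the parent route below TA, certified from AL 28544 and
  FRAME⁗ 28546 by the gate-certified `TorsionAvatarReduction.closes` (`frame_of_host`); from the grand-host's binders by the twin `Torsion.closes` (`frame_of_grandhost`).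

## Kernels
I exactness: `ta_iff_levelAvatar`, `levelAvatar_iff_cells` (LA ⟺ TZ ∧ TP, one excluded middle `defect_dichotomy`), `ta_iff_cells` (TA ⟺ TZ ∧ TP), `ta_twin_iff_cells`.
II necessity: Langlands ⟹ TA (`Torsion.torsionAvatar_of_langlands`) ⟹ LA, TZ, TP; FL outright; FRAME⁵ trivially and from the host; REG 28274 / NLR 28006 ⟹ the cells
(`cells_of_regular`, `cells_of_nonLiftable`).  III lines and rungs as above.  IV deciding theorems: `closes : TZ → TP → FL → FRAME⁵ → Langlands` (pure logic = the
certified glue of the child route, cone 4), `closes_engine` (FL discharged: TZ → TP → FRAME⁵ → Langlands), `closes_host` (over route-Langlands-TorsionAvatarReduction's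
binders: TZ → TP → AL → FRAME⁗ → Langlands via `TorsionAvatarReduction.closes (ta_of_cells …)`), `closes_grandhost` (RegularAvatarReduction's, via `Torsion.closes`),
`closes_greatgrandhost` (NonLiftableResidueReduction's, via `Torsion.closes_host`).  Every kernel's axioms = [propext, Classical.choice, Quot.sound] (kit `#guard_msgs` ×48).

What is NOT claimed: no stub is proved (CAV at ℓ = 2 is the dyadic gap of every torsion-vanishing theorem in print; PA is Calegari–Geraghty at ℓ = 2); TZ ↛ TA, TP ↛ TA,
TZ ↛ TP, TP ↛ TZ, no cell ↛ Langlands, no stub ↛ its cell (kit probes, 105 expected-fail examples, 0 unexpected successes).  References: Scholze 2015 (Ann. Math. 182)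
§V.4; Gee–Newton 2020 (JIMJ) §2.1; Calegari–Geraghty 2018 (Invent. 211); Calegari–Venkatesh 2019 (Astérisque 409) §1.4; Caraiani–Tamiozzo 2023 (Compos. 159) Thm 7.1.1;
Deligne–Serre 1974 Lemme 6.11 (tree); Kisin 2009 (Invent. 178); Caraiani–Shin survey arXiv:2311.13382 §3–4.
-/

set_option linter.dupNamespace false

namespace Summit.Langlands.Langlands.Theorems.LevelOneDyadic.FiniteLevel

open scoped NumberField
open Filter IsDedekindDomain Polynomial
open Literature.NumberTheory.GaloisRepresentations Literature.NumberTheory.Automorphic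
open Literature.NumberTheory.Automorphic.BigHeckeGLn
open Summit.Langlands.Langlands.Theses
open Summit.Langlands.Langlands.Theorems.LevelOneDyadic
open Summit.Langlands.Langlands.Theorems.LevelOneDyadic.Residue
open Summit.Langlands.Langlands.Theorems.LevelOneDyadic.Liftable

/-! ## ENGINE — in `Theorems/LevelOneDyadicFiniteLevelEngine.lean` (levelwise factorisation; imported). -/

variable {K : Type} [Field K] [NumberField K] {n : ℕ}

/-! ## Vocabulary — the LEVEL DIAL: the torsion avatar read in ONE finite-level Hecke algebra 𝕋(U_r, ℤ/2^s, i) -/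

/-- THE LEVEL DIAL (the finite-level NORMAL FORM of g17's torsion-avatar dial).  ρ : Γ_K → GL_n(ℚ̄₂) has a LEVEL AVATAR: for some index
(r, s, i) some framed reduction τ̄ : Γ_K → GL_n(𝔽̄₂) of ρ (tree `FramedGaloisRep.IsReductionOf`, 𝔽̄₂ = ℤ̄₂/𝔪 discrete) is ASSOCIATED (tree
`IsAssociatedFamily`: unramified at v ∤ 2 with det(X − τ̄(Frob_v)) = the Hecke–Frobenius polynomial of the family) with an eigensystem
ψ : 𝕋(U_r, ℤ/2^s, i) → 𝔽̄₂ of the FINITE-LEVEL Hecke algebra `TameLevel.levelHeckeSubring (r, s, i)` = Scholze's 𝕋_{F,S}(U_r, i, s) = the image of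
the spherical Hecke algebra in End(H^i(X_{U_r}, ℤ/2^s)) for GL_n/K at full tame level, U_r = GL_n(𝒪̂_K) ∩ (depth-2^r congruence at v ∣ 2), read on the
generators `levelHeckeT (r,s,i) v j = T_{v,j}`.  In words: «ρ̄ OCCURS IN H^i(X_{U(2^r)}, ℤ/2^s)».  No continuity clause — a finite level is discrete; the index is
a WITNESS one can name in a table (Şengün / Torrey / Ash–Doud–Pollack list eigenclasses by level and degree).  EQUIVALENT to the torsion avatar
(`hasTorsionAvatar_iff_hasLevelAvatar`, by the engine). [dial, ℓ = 2, normal form] -/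
def HasLevelAvatar (ρ : FramedGaloisRep K (PadicAlgCl 2) n) : Prop := (letI : TopologicalSpace (Literature.NumberTheory.GaloisRepresentations.padicAlgClResidueField 2) := ⊥; ∃ (idx : ℕ × ℕ × ℕ) (τ : Literature.NumberTheory.GaloisRepresentations.FramedGaloisRep K (Literature.NumberTheory.GaloisRepresentations.padicAlgClResidueField 2) n), ρ.IsReductionOf (RingHom.id (Literature.NumberTheory.GaloisRepresentations.padicAlgClResidueField 2)) (τ : Field.absoluteGaloisGroup K →* GL (Fin n) (Literature.NumberTheory.GaloisRepresentations.padicAlgClResidueField 2)) ∧ ∃ ψ : (Literature.NumberTheory.Automorphic.BigHeckeGLn.TameLevel.full n K 2).levelHeckeSubring idx →+* Literature.NumberTheory.GaloisRepresentations.padicAlgClResidueField 2, Literature.NumberTheory.Automorphic.BigHeckeGLn.IsAssociatedFamily n (Literature.NumberTheory.Automorphic.BigHeckeGLn.TameLevel.full n K 2).bad (fun v j => ψ ((Literature.NumberTheory.Automorphic.BigHeckeGLn.TameLevel.full n K 2).levelHeckeT idx v j)) τ)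

/-! ## The pieces (filed texts verbatim = the child route's items; TA / AL / FRAME⁗ = the born route-Langlands-TorsionAvatarReduction decls, BY NAME) -/

/-- [node-only · the ONE EQUIV of the node: TA in finite-level language, `ta_iff_levelAvatar` (both directions PROVED by the engine); split beneath into
TZ ∧ TP EXACTLY (`levelAvatar_iff_cells`)]  TA with the torsion avatar replaced by a level avatar. -/
def LevelAvatarAutomorphy : Prop := ∀ (K : Type) [Field K] [NumberField K] (n : ℕ) (hcpt : Literature.NumberTheory.Automorphic.isCompact_glFiniteIntegralLevel n K), 0 < n → ∀ (ι : PadicAlgCl 2 ≃+* ℂ) (ρ : Literature.NumberTheory.GaloisRepresentations.FramedGaloisRep K (PadicAlgCl 2) n), ρ.toGaloisRep.IsIrreducible → (∀ τ : Field.absoluteGaloisGroup K →* GL (Fin n) (Literature.NumberTheory.GaloisRepresentations.padicAlgClResidueField 2), ρ.IsResidualRepOf (RingHom.id (Literature.NumberTheory.GaloisRepresentations.padicAlgClResidueField 2)) τ → ¬ IsSolvable τ.range) → ¬ (∃ (σ : Literature.NumberTheory.GaloisRepresentations.FramedGaloisRep K (PadicAlgCl 2) n) (τ : Field.absoluteGaloisGroup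 K →* GL (Fin n) (Literature.NumberTheory.GaloisRepresentations.padicAlgClResidueField 2)), (Set.range (fun g : Field.absoluteGaloisGroup K => σ g)).Finite ∧ σ.toGaloisRep.IsIrreducible ∧ ρ.IsResidualRepOf (RingHom.id (Literature.NumberTheory.GaloisRepresentations.padicAlgClResidueField 2)) τ ∧ σ.IsResidualRepOf (RingHom.id (Literature.NumberTheory.GaloisRepresentations.padicAlgClResidueField 2)) τ) → ((∀ᶠ v : IsDedekindDomain.HeightOneSpectrum (NumberField.RingOfIntegers K) in cofinite, ρ.IsUnramifiedAt v) ∧ ∀ (v : IsDedekindDomain.HeightOneSpectrum (NumberField.RingOfIntegers K)) (hv : ((2 : ℕ) : NumberField.RingOfIntegers K) ∈ v.asIdeal), (Literature.NumberTheory.PAdicHodge.fontainePstAdicCompletion v 2 hv).IsDeRhamFramed (ρ.toLocal v)) → (∀ (v : IsDedekindDomain.HeightOneSpectrum (NumberField.RingOfIntegers K)) (hv : ((2 : ℕ) : NumberField.RingOfIntegers K) ∈ v.asIdeal), ∀ e : v.adicCompletion K →+* PadicAlgCl 2, Continuous e → (ρ.labelledHodgeTateWeightsAt v (Literature.NumberTheory.PAdicHodge.fontainePstAdicCompletion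 v 2 hv).algebra (Literature.NumberTheory.PAdicHodge.fontainePstAdicCompletion v 2 hv).𝔅 e).Nodup) → (∀ v : IsDedekindDomain.HeightOneSpectrum (NumberField.RingOfIntegers K), ((2 : ℕ) : NumberField.RingOfIntegers K) ∉ v.asIdeal → ρ.IsUnramifiedAt v) → (letI : TopologicalSpace (Literature.NumberTheory.GaloisRepresentations.padicAlgClResidueField 2) := ⊥; ∃ (idx : ℕ × ℕ × ℕ) (τ : Literature.NumberTheory.GaloisRepresentations.FramedGaloisRep K (Literature.NumberTheory.GaloisRepresentations.padicAlgClResidueField 2) n), ρ.IsReductionOf (RingHom.id (Literature.NumberTheory.GaloisRepresentations.padicAlgClResidueField 2)) (τ : Field.absoluteGaloisGroup K →* GL (Fin n) (Literature.NumberTheory.GaloisRepresentations.padicAlgClResidueField 2)) ∧ ∃ ψ : (Literature.NumberTheory.Automorphic.BigHeckeGLn.TameLevel.full n K 2).levelHeckeSubring idx →+* Literature.NumberTheory.GaloisRepresentations.padicAlgClResidueField 2, Literature.NumberTheory.Automorphic.BigHeckeGLn.IsAssociatedFamily n (Literature.NumberTheory.Automorphic.BigHeckeGLn.TameLevel.full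 n K 2).bad (fun v j => ψ ((Literature.NumberTheory.Automorphic.BigHeckeGLn.TameLevel.full n K 2).levelHeckeT idx v j)) τ) → ∃ π : Literature.NumberTheory.Automorphic.CuspidalAutomorphicRepData n K hcpt, π.1.IsLAlgebraic ∧ ∀ᶠ v : IsDedekindDomain.HeightOneSpectrum (NumberField.RingOfIntegers K) in cofinite, ρ.IsUnramifiedAt v ∧ (∃ α : Multiset ℂ, π.1.HasSatakeParamAt v α) ∧ ∀ α : Multiset ℂ, π.1.HasSatakeParamAt v α → ∃ P Q : Polynomial (Valued.v : Valuation (PadicAlgCl 2) NNReal).valuationSubring, ρ.HasFrobCharpolyAt v (P.map (Valued.v : Valuation (PadicAlgCl 2) NNReal).valuationSubring.subtype) ∧ Literature.NumberTheory.Automorphic.arithFrobPolyOfSatake ι v.residueCard 1 α = Q.map (Valued.v : Valuation (PadicAlgCl 2) NNReal).valuationSubring.subtype ∧ P.map (IsLocalRing.residue (Valued.v : Valuation (PadicAlgCl 2) NNReal).valuationSubring) = Q.map (IsLocalRing.residue (Valued.v : Valuation (PadicAlgCl 2) NNReal).valuationSubring)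

/-- [crux TZ · NEW · WEAKER(`defectZero_of_ta`, `defectZero_of_langlands`; no `TZ → TA`: the positive-defect instances are outside it) · OPEN · ATTACKABLE NOW:
DEFECT ZERO (n = 2, K totally real — the only sector of the box with l₀ = 0): a mod-2 eigenclass in H^i(X_{U(2^r)}, ℤ/2^s) of the HILBERT MODULAR VARIETY (or, by
Jacquet–Langlands, of a Shimura curve / a totally definite quaternion set) at an insoluble, non-Artin, generic residue τ̄ = ρ̄ LIFTS: (1) torsion-freeness /
vanishing outside the middle degree at generic non-Eisenstein 𝔪 (Caraiani–Tamiozzo 2023 — ℓ > 2 in print: THE DYADIC GAP), (2) the tree-PROVED Deligne–Serre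
lifting lemma `deligneSerre_lifting_of_free` ⇒ a characteristic-0 eigenform π′ with ρ_{π′} ≡ ρ̄, cuspidal since non-Eisenstein ⇒ a CLASSICAL AVATAR, (3) 2-adic
automorphy lifting from π′ to ρ (Kisin 2-adic Barsotti–Tate / Thorne residually-dihedral / Pilloni–Stroh overconvergent Hilbert at p = 2 — partial) ·
line CAV ∧ ALT (`line_TZ.lean`) · rung: depth r = 0 (Dembélé's level-one sector)] -/
def DefectZeroTorsionAutomorphy : Prop := ∀ (K : Type) [Field K] [NumberField K] (n : ℕ) (hcpt : Literature.NumberTheory.Automorphic.isCompact_glFiniteIntegralLevel n K), 0 < n → ∀ (ι : PadicAlgCl 2 ≃+* ℂ) (ρ : Literature.NumberTheory.GaloisRepresentations.FramedGaloisRep K (PadicAlgCl 2) n), ρ.toGaloisRep.IsIrreducible → (∀ τ : Field.absoluteGaloisGroup K →* GL (Fin n) (Literature.NumberTheory.GaloisRepresentations.padicAlgClResidueField 2), ρ.IsResidualRepOf (RingHom.id (Literature.NumberTheory.GaloisRepresentations.padicAlgClResidueField 2)) τ → ¬ IsSolvable τ.range) → ¬ (∃ (σ : Literature.NumberTheory.GaloisRepresentations.FramedGaloisRep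 K (PadicAlgCl 2) n) (τ : Field.absoluteGaloisGroup K →* GL (Fin n) (Literature.NumberTheory.GaloisRepresentations.padicAlgClResidueField 2)), (Set.range (fun g : Field.absoluteGaloisGroup K => σ g)).Finite ∧ σ.toGaloisRep.IsIrreducible ∧ ρ.IsResidualRepOf (RingHom.id (Literature.NumberTheory.GaloisRepresentations.padicAlgClResidueField 2)) τ ∧ σ.IsResidualRepOf (RingHom.id (Literature.NumberTheory.GaloisRepresentations.padicAlgClResidueField 2)) τ) → ((∀ᶠ v : IsDedekindDomain.HeightOneSpectrum (NumberField.RingOfIntegers K) in cofinite, ρ.IsUnramifiedAt v) ∧ ∀ (v : IsDedekindDomain.HeightOneSpectrum (NumberField.RingOfIntegers K)) (hv : ((2 : ℕ) : NumberField.RingOfIntegers K) ∈ v.asIdeal), (Literature.NumberTheory.PAdicHodge.fontainePstAdicCompletion v 2 hv).IsDeRhamFramed (ρ.toLocal v)) → (∀ (v : IsDedekindDomain.HeightOneSpectrum (NumberField.RingOfIntegers K)) (hv : ((2 : ℕ) : NumberField.RingOfIntegers K) ∈ v.asIdeal), ∀ e : v.adicCompletion K →+* PadicAlgCl 2, Continuous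 e → (ρ.labelledHodgeTateWeightsAt v (Literature.NumberTheory.PAdicHodge.fontainePstAdicCompletion v 2 hv).algebra (Literature.NumberTheory.PAdicHodge.fontainePstAdicCompletion v 2 hv).𝔅 e).Nodup) → (∀ v : IsDedekindDomain.HeightOneSpectrum (NumberField.RingOfIntegers K), ((2 : ℕ) : NumberField.RingOfIntegers K) ∉ v.asIdeal → ρ.IsUnramifiedAt v) → (n = 2 ∧ NumberField.IsTotallyReal K) → (letI : TopologicalSpace (Literature.NumberTheory.GaloisRepresentations.padicAlgClResidueField 2) := ⊥; ∃ (idx : ℕ × ℕ × ℕ) (τ : Literature.NumberTheory.GaloisRepresentations.FramedGaloisRep K (Literature.NumberTheory.GaloisRepresentations.padicAlgClResidueField 2) n), ρ.IsReductionOf (RingHom.id (Literature.NumberTheory.GaloisRepresentations.padicAlgClResidueField 2)) (τ : Field.absoluteGaloisGroup K →* GL (Fin n) (Literature.NumberTheory.GaloisRepresentations.padicAlgClResidueField 2)) ∧ ∃ ψ : (Literature.NumberTheory.Automorphic.BigHeckeGLn.TameLevel.full n K 2).levelHeckeSubring idx →+* Literature.NumberTheory.GaloisRepresentations.padicAlgClResidueField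 2, Literature.NumberTheory.Automorphic.BigHeckeGLn.IsAssociatedFamily n (Literature.NumberTheory.Automorphic.BigHeckeGLn.TameLevel.full n K 2).bad (fun v j => ψ ((Literature.NumberTheory.Automorphic.BigHeckeGLn.TameLevel.full n K 2).levelHeckeT idx v j)) τ) → ∃ π : Literature.NumberTheory.Automorphic.CuspidalAutomorphicRepData n K hcpt, π.1.IsLAlgebraic ∧ ∀ᶠ v : IsDedekindDomain.HeightOneSpectrum (NumberField.RingOfIntegers K) in cofinite, ρ.IsUnramifiedAt v ∧ (∃ α : Multiset ℂ, π.1.HasSatakeParamAt v α) ∧ ∀ α : Multiset ℂ, π.1.HasSatakeParamAt v α → ∃ P Q : Polynomial (Valued.v : Valuation (PadicAlgCl 2) NNReal).valuationSubring, ρ.HasFrobCharpolyAt v (P.map (Valued.v : Valuation (PadicAlgCl 2) NNReal).valuationSubring.subtype) ∧ Literature.NumberTheory.Automorphic.arithFrobPolyOfSatake ι v.residueCard 1 α = Q.map (Valued.v : Valuation (PadicAlgCl 2) NNReal).valuationSubring.subtype ∧ P.map (IsLocalRing.residue (Valued.v : Valuation (PadicAlgCl 2) NNReal).valuationSubring)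 = Q.map (IsLocalRing.residue (Valued.v : Valuation (PadicAlgCl 2) NNReal).valuationSubring)

/-- [crux TP · NEW · THE DECLARED RESIDUAL of this route · WEAKER(`positiveDefect_of_ta`, `positiveDefect_of_langlands`; no `TP → TA`) · OPEN · BARRIER:
POSITIVE DEFECT (n ≥ 3, or n = 2 with K not totally real: l₀ > 0 — exactly `Literature.Barriers.Langlands.TaylorWilesNumericalCoincidence`): the
Calegari–Geraghty sector at ℓ = 2 — R = 𝕋 by patching COMPLEXES over the range [q₀, q₀ + l₀], conditional on Galois representations with local-global
compatibility for torsion classes (Scholze / Caraiani–Scholze / ACC+ : CM or totally real K only — over general K not even that) and on vanishing outside the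
range; then classicality of a de Rham HT-regular 2-adically automorphic ρ · birth PA ∧ CLS (`birth_TP.lean`) · rung: Bianchi (n = 2, K imaginary quadratic:
Şengün–Torrey territory, I-g17.1)] -/
def PositiveDefectTorsionAutomorphy : Prop := ∀ (K : Type) [Field K] [NumberField K] (n : ℕ) (hcpt : Literature.NumberTheory.Automorphic.isCompact_glFiniteIntegralLevel n K), 0 < n → ∀ (ι : PadicAlgCl 2 ≃+* ℂ) (ρ : Literature.NumberTheory.GaloisRepresentations.FramedGaloisRep K (PadicAlgCl 2) n), ρ.toGaloisRep.IsIrreducible → (∀ τ : Field.absoluteGaloisGroup K →* GL (Fin n) (Literature.NumberTheory.GaloisRepresentations.padicAlgClResidueField 2), ρ.IsResidualRepOf (RingHom.id (Literature.NumberTheory.GaloisRepresentations.padicAlgClResidueField 2)) τ → ¬ IsSolvable τ.range) → ¬ (∃ (σ : Literature.NumberTheory.GaloisRepresentations.FramedGaloisRep K (PadicAlgCl 2) n) (τ : Field.absoluteGaloisGroup K →* GL (Fin n) (Literature.NumberTheory.GaloisRepresentations.padicAlgClResidueField 2)), (Set.range (fun g : Field.absoluteGaloisGroup K => σ g)).Finite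 ∧ σ.toGaloisRep.IsIrreducible ∧ ρ.IsResidualRepOf (RingHom.id (Literature.NumberTheory.GaloisRepresentations.padicAlgClResidueField 2)) τ ∧ σ.IsResidualRepOf (RingHom.id (Literature.NumberTheory.GaloisRepresentations.padicAlgClResidueField 2)) τ) → ((∀ᶠ v : IsDedekindDomain.HeightOneSpectrum (NumberField.RingOfIntegers K) in cofinite, ρ.IsUnramifiedAt v) ∧ ∀ (v : IsDedekindDomain.HeightOneSpectrum (NumberField.RingOfIntegers K)) (hv : ((2 : ℕ) : NumberField.RingOfIntegers K) ∈ v.asIdeal), (Literature.NumberTheory.PAdicHodge.fontainePstAdicCompletion v 2 hv).IsDeRhamFramed (ρ.toLocal v)) → (∀ (v : IsDedekindDomain.HeightOneSpectrum (NumberField.RingOfIntegers K)) (hv : ((2 : ℕ) : NumberField.RingOfIntegers K) ∈ v.asIdeal), ∀ e : v.adicCompletion K →+* PadicAlgCl 2, Continuous e → (ρ.labelledHodgeTateWeightsAt v (Literature.NumberTheory.PAdicHodge.fontainePstAdicCompletion v 2 hv).algebra (Literature.NumberTheory.PAdicHodge.fontainePstAdicCompletion v 2 hv).𝔅 e).Nodup)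 → (∀ v : IsDedekindDomain.HeightOneSpectrum (NumberField.RingOfIntegers K), ((2 : ℕ) : NumberField.RingOfIntegers K) ∉ v.asIdeal → ρ.IsUnramifiedAt v) → ¬ (n = 2 ∧ NumberField.IsTotallyReal K) → (letI : TopologicalSpace (Literature.NumberTheory.GaloisRepresentations.padicAlgClResidueField 2) := ⊥; ∃ (idx : ℕ × ℕ × ℕ) (τ : Literature.NumberTheory.GaloisRepresentations.FramedGaloisRep K (Literature.NumberTheory.GaloisRepresentations.padicAlgClResidueField 2) n), ρ.IsReductionOf (RingHom.id (Literature.NumberTheory.GaloisRepresentations.padicAlgClResidueField 2)) (τ : Field.absoluteGaloisGroup K →* GL (Fin n) (Literature.NumberTheory.GaloisRepresentations.padicAlgClResidueField 2)) ∧ ∃ ψ : (Literature.NumberTheory.Automorphic.BigHeckeGLn.TameLevel.full n K 2).levelHeckeSubring idx →+* Literature.NumberTheory.GaloisRepresentations.padicAlgClResidueField 2, Literature.NumberTheory.Automorphic.BigHeckeGLn.IsAssociatedFamily n (Literature.NumberTheory.Automorphic.BigHeckeGLn.TameLevel.full n K 2).bad (fun v j => ψ ((Literature.NumberTheory.Automorphic.BigHeckeGLn.TameLevel.full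 n K 2).levelHeckeT idx v j)) τ) → ∃ π : Literature.NumberTheory.Automorphic.CuspidalAutomorphicRepData n K hcpt, π.1.IsLAlgebraic ∧ ∀ᶠ v : IsDedekindDomain.HeightOneSpectrum (NumberField.RingOfIntegers K) in cofinite, ρ.IsUnramifiedAt v ∧ (∃ α : Multiset ℂ, π.1.HasSatakeParamAt v α) ∧ ∀ α : Multiset ℂ, π.1.HasSatakeParamAt v α → ∃ P Q : Polynomial (Valued.v : Valuation (PadicAlgCl 2) NNReal).valuationSubring, ρ.HasFrobCharpolyAt v (P.map (Valued.v : Valuation (PadicAlgCl 2) NNReal).valuationSubring.subtype) ∧ Literature.NumberTheory.Automorphic.arithFrobPolyOfSatake ι v.residueCard 1 α = Q.map (Valued.v : Valuation (PadicAlgCl 2) NNReal).valuationSubring.subtype ∧ P.map (IsLocalRing.residue (Valued.v : Valuation (PadicAlgCl 2) NNReal).valuationSubring) = Q.map (IsLocalRing.residue (Valued.v : Valuation (PadicAlgCl 2) NNReal).valuationSubring)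

/-- [support FL · NEW · PROVED HERE (`finiteLevelNormalForm_holds`, by the ENGINE): the finite-level NORMAL FORM — every torsion avatar (a continuous mod-2
eigensystem of the COMPLETED-cohomology Hecke algebra 𝕋(K^{(2)})) is a level avatar (an eigensystem of ONE finite-level Hecke algebra 𝕋(U_r, ℤ/2^s, i)).
Open kernel ⇒ finitely many indices matter (product of discrete factors); the DOMAIN TRICK ⇒ one index matters (ψ(ab) = ψ(a)ψ(b) across the two-sided ideals
«vanishes at index j»); descend along the surjection 𝕋(K^{(2)}) ↠ 𝕋(U_r, ℤ/2^s, i).  Langlands ⟹ FL trivially (it is a theorem).] -/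
def FiniteLevelNormalForm : Prop := ∀ (K : Type) [Field K] [NumberField K] (n : ℕ) (ρ : Literature.NumberTheory.GaloisRepresentations.FramedGaloisRep K (PadicAlgCl 2) n), (letI : TopologicalSpace (Literature.NumberTheory.GaloisRepresentations.padicAlgClResidueField 2) := ⊥; ∃ τ : Literature.NumberTheory.GaloisRepresentations.FramedGaloisRep K (Literature.NumberTheory.GaloisRepresentations.padicAlgClResidueField 2) n, ρ.IsReductionOf (RingHom.id (Literature.NumberTheory.GaloisRepresentations.padicAlgClResidueField 2)) (τ : Field.absoluteGaloisGroup K →* GL (Fin n) (Literature.NumberTheory.GaloisRepresentations.padicAlgClResidueField 2)) ∧ (Literature.NumberTheory.Automorphic.BigHeckeGLn.TameLevel.full n K 2).IsPadicallyAutomorphic τ) → (letI : TopologicalSpace (Literature.NumberTheory.GaloisRepresentations.padicAlgClResidueField 2) := ⊥; ∃ (idx : ℕ × ℕ × ℕ) (τ : Literature.NumberTheory.GaloisRepresentations.FramedGaloisRep K (Literature.NumberTheory.GaloisRepresentations.padicAlgClResidueField 2) n), ρ.IsReductionOf (RingHom.id (Literature.NumberTheory.GaloisRepresentations.padicAlgClResidueField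 2)) (τ : Field.absoluteGaloisGroup K →* GL (Fin n) (Literature.NumberTheory.GaloisRepresentations.padicAlgClResidueField 2)) ∧ ∃ ψ : (Literature.NumberTheory.Automorphic.BigHeckeGLn.TameLevel.full n K 2).levelHeckeSubring idx →+* Literature.NumberTheory.GaloisRepresentations.padicAlgClResidueField 2, Literature.NumberTheory.Automorphic.BigHeckeGLn.IsAssociatedFamily n (Literature.NumberTheory.Automorphic.BigHeckeGLn.TameLevel.full n K 2).bad (fun v j => ψ ((Literature.NumberTheory.Automorphic.BigHeckeGLn.TameLevel.full n K 2).levelHeckeT idx v j)) τ)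

/-- [support FRAME⁵ · content = the born route-Langlands-TorsionAvatarReduction rev 0 VERBATIM below TA: `TA → Langlands`, i.e. its two other deciding binders
AL `AvatarlessResidueAutomorphy` 28544 (declared residual there) and FRAME⁗ `RegularResidueFrame` 28546 through `TorsionAvatarReduction.closes` (certified
`frame_of_host`); Langlands ⟹ FRAME⁵ trivially (`frame_of_langlands`).  Same device as FRAME⁗ / FRAME‴ / FRAME″ up the lineage; by-name reference, no restatement.] -/
def TorsionAvatarFrame : Prop := Summit.Langlands.Langlands.Theses.TorsionAvatarReduction.TorsionAvatarAutomorphy → _root_.Langlands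

/-! ## Bridges — the born route decls are the tree twin's (same text, `Iff.rfl`); every filed text is the vocabulary form, definitionally -/

/-- The born route decl TA (stmt-Langlands-28545) IS the tree twin's `Torsion.TorsionAvatarAutomorphy`. -/
theorem torsionAvatarAutomorphy_route_iff_twin :
    TorsionAvatarReduction.TorsionAvatarAutomorphy ↔ Torsion.TorsionAvatarAutomorphy :=
  Iff.rfl

/-- The born route decl AL (stmt-Langlands-28544) IS the twin's `Torsion.AvatarlessResidueAutomorphy`. -/
theorem avatarlessResidueAutomorphy_route_iff_twin :
    TorsionAvatarReduction.AvatarlessResidueAutomorphy ↔ Torsion.AvatarlessResidueAutomorphy :=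
  Iff.rfl

/-- The born route decl FRAME⁗ (stmt-Langlands-28546) IS the twin's `Torsion.RegularResidueFrame`. -/
theorem regularResidueFrame_route_iff_twin :
    TorsionAvatarReduction.RegularResidueFrame ↔ Torsion.RegularResidueFrame :=
  Iff.rfl

/-- The level dial in vocabulary form. -/
theorem hasLevelAvatar_iff (ρ : FramedGaloisRep K (PadicAlgCl 2) n) : HasLevelAvatar ρ ↔
    letI : TopologicalSpace (padicAlgClResidueField 2) := ⊥
    ∃ (idx : ℕ × ℕ × ℕ) (τ : FramedGaloisRep K (padicAlgClResidueField 2) n),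
      ρ.IsReductionOf (RingHom.id _) (τ : Field.absoluteGaloisGroup K →* GL (Fin n) (padicAlgClResidueField 2)) ∧
        ∃ ψ : (TameLevel.full n K 2).levelHeckeSubring idx →+* padicAlgClResidueField 2,
          IsAssociatedFamily n (TameLevel.full n K 2).bad (fun v j => ψ ((TameLevel.full n K 2).levelHeckeT idx v j)) τ :=
  Iff.rfl

/-- TA (the born route decl) in vocabulary form (the twin's `torsionAvatarAutomorphy_iff`). -/
theorem torsionAvatarAutomorphy_iff : TorsionAvatarReduction.TorsionAvatarAutomorphy ↔
    ∀ (K : Type) [Field K] [NumberField K] (n : ℕ) (hcpt : isCompact_glFiniteIntegralLevel n K), 0 < n →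
      ∀ (ι : PadicAlgCl 2 ≃+* ℂ) (ρ : FramedGaloisRep K (PadicAlgCl 2) n), ρ.toGaloisRep.IsIrreducible →
        IsResiduallyInsoluble ρ → ¬ IsArtinLiftableResidue ρ → IsPinnedGeometric ρ → Regular.IsHodgeTateRegularAboveTwo ρ →
          IsUnramifiedAwayFromTwo ρ → Torsion.HasTorsionAvatar ρ → IsResiduallyAutomorphic hcpt ι ρ :=
  Iff.rfl

/-- LA in vocabulary form. -/
theorem levelAvatarAutomorphy_iff : LevelAvatarAutomorphy ↔
    ∀ (K : Type) [Field K] [NumberField K] (n : ℕ) (hcpt : isCompact_glFiniteIntegralLevel n K), 0 < n →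
      ∀ (ι : PadicAlgCl 2 ≃+* ℂ) (ρ : FramedGaloisRep K (PadicAlgCl 2) n), ρ.toGaloisRep.IsIrreducible →
        IsResiduallyInsoluble ρ → ¬ IsArtinLiftableResidue ρ → IsPinnedGeometric ρ → Regular.IsHodgeTateRegularAboveTwo ρ →
          IsUnramifiedAwayFromTwo ρ → HasLevelAvatar ρ → IsResiduallyAutomorphic hcpt ι ρ :=
  Iff.rfl

/-- TZ in vocabulary form. -/
theorem defectZeroTorsionAutomorphy_iff : DefectZeroTorsionAutomorphy ↔
    ∀ (K : Type) [Field K] [NumberField K] (n : ℕ) (hcpt : isCompact_glFiniteIntegralLevel n K), 0 < n →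
      ∀ (ι : PadicAlgCl 2 ≃+* ℂ) (ρ : FramedGaloisRep K (PadicAlgCl 2) n), ρ.toGaloisRep.IsIrreducible →
        IsResiduallyInsoluble ρ → ¬ IsArtinLiftableResidue ρ → IsPinnedGeometric ρ → Regular.IsHodgeTateRegularAboveTwo ρ →
          IsUnramifiedAwayFromTwo ρ → (n = 2 ∧ NumberField.IsTotallyReal K) → HasLevelAvatar ρ → IsResiduallyAutomorphic hcpt ι ρ :=
  Iff.rfl

/-- TP in vocabulary form. -/
theorem positiveDefectTorsionAutomorphy_iff : PositiveDefectTorsionAutomorphy ↔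
    ∀ (K : Type) [Field K] [NumberField K] (n : ℕ) (hcpt : isCompact_glFiniteIntegralLevel n K), 0 < n →
      ∀ (ι : PadicAlgCl 2 ≃+* ℂ) (ρ : FramedGaloisRep K (PadicAlgCl 2) n), ρ.toGaloisRep.IsIrreducible →
        IsResiduallyInsoluble ρ → ¬ IsArtinLiftableResidue ρ → IsPinnedGeometric ρ → Regular.IsHodgeTateRegularAboveTwo ρ →
          IsUnramifiedAwayFromTwo ρ → ¬ (n = 2 ∧ NumberField.IsTotallyReal K) → HasLevelAvatar ρ → IsResiduallyAutomorphic hcpt ι ρ :=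
  Iff.rfl

/-- FL in vocabulary form: torsion avatar ⟹ level avatar, for every ρ. -/
theorem finiteLevelNormalForm_iff : FiniteLevelNormalForm ↔
    ∀ (K : Type) [Field K] [NumberField K] (n : ℕ) (ρ : FramedGaloisRep K (PadicAlgCl 2) n), Torsion.HasTorsionAvatar ρ → HasLevelAvatar ρ :=
  Iff.rfl

/-- FRAME⁵ is literally `TA → Langlands`. -/
theorem torsionAvatarFrame_iff :
    TorsionAvatarFrame ↔ (TorsionAvatarReduction.TorsionAvatarAutomorphy → _root_.Langlands) :=
  Iff.rfl

/-! ## KERNEL 0 — the engine on the dial: torsion avatar ⟺ level avatar (no junk either way: every ρ has a reduction, `Torsion.exists_isReductionOf`) -/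

/-- Torsion avatar ⟹ level avatar: the levelwise factorisation of the continuous mod-2 eigensystem (ENGINE `exists_levelwise_of_isPadicallyAutomorphic`). -/
theorem hasLevelAvatar_of_hasTorsionAvatar {ρ : FramedGaloisRep K (PadicAlgCl 2) n} (h : Torsion.HasTorsionAvatar ρ) : HasLevelAvatar ρ := by
  letI : TopologicalSpace (padicAlgClResidueField 2) := ⊥
  haveI : DiscreteTopology (padicAlgClResidueField 2) := ⟨rfl⟩
  obtain ⟨τ, hτ, hpa⟩ := h
  obtain ⟨idx, ψ', hass⟩ := exists_levelwise_of_isPadicallyAutomorphic (TameLevel.full n K 2) hpa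
  exact ⟨idx, τ, hτ, ψ', hass⟩

/-- Level avatar ⟹ torsion avatar: compose the finite-level eigensystem with the continuous level projection (ENGINE `isPadicallyAutomorphic_of_levelwise`). -/
theorem hasTorsionAvatar_of_hasLevelAvatar {ρ : FramedGaloisRep K (PadicAlgCl 2) n} (h : HasLevelAvatar ρ) : Torsion.HasTorsionAvatar ρ := by
  letI : TopologicalSpace (padicAlgClResidueField 2) := ⊥
  haveI : DiscreteTopology (padicAlgClResidueField 2) := ⟨rfl⟩
  obtain ⟨idx, τ, hτ, ψ', hass⟩ := h
  exact ⟨τ, hτ, isPadicallyAutomorphic_of_levelwise (TameLevel.full n K 2) ψ' hass⟩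

/-- THE DIAL EQUIVALENCE: torsion avatar ⟺ level avatar. -/
theorem hasTorsionAvatar_iff_hasLevelAvatar (ρ : FramedGaloisRep K (PadicAlgCl 2) n) : Torsion.HasTorsionAvatar ρ ↔ HasLevelAvatar ρ :=
  ⟨hasLevelAvatar_of_hasTorsionAvatar, hasTorsionAvatar_of_hasLevelAvatar⟩

/-- One excluded middle: the defect of Res_{K/ℚ} GL_n on the box is zero or positive. -/
theorem defect_dichotomy (K : Type) [Field K] [NumberField K] (n : ℕ) :
    (n = 2 ∧ NumberField.IsTotallyReal K) ∨ ¬ (n = 2 ∧ NumberField.IsTotallyReal K) :=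
  em _

/-! ## KERNEL I — exactness: TA ⟺ LA (the ONE EQUIV, by the engine) and LA ⟺ TZ ∧ TP (one excluded middle on the defect); FL holds -/

/-- TA ⟹ LA (engine, converse direction on the dial). -/
theorem levelAvatar_of_ta (hT : TorsionAvatarReduction.TorsionAvatarAutomorphy) : LevelAvatarAutomorphy :=
  fun K _ _ n hcpt hn ι ρ hirr hins hnl hgeo hreg hlvl hav =>
    hT K n hcpt hn ι ρ hirr hins hnl hgeo hreg hlvl (hasTorsionAvatar_of_hasLevelAvatar hav)

/-- LA ⟹ TA (engine, direct direction on the dial: THE REDUCTION TO NORMAL FORM). -/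
theorem ta_of_levelAvatar (hL : LevelAvatarAutomorphy) : TorsionAvatarReduction.TorsionAvatarAutomorphy :=
  fun K _ _ n hcpt hn ι ρ hirr hins hnl hgeo hreg hlvl hav =>
    hL K n hcpt hn ι ρ hirr hins hnl hgeo hreg hlvl (hasLevelAvatar_of_hasTorsionAvatar hav)

/-- THE ONE EQUIV OF THE NODE: TA ⟺ LA. -/
theorem ta_iff_levelAvatar : TorsionAvatarReduction.TorsionAvatarAutomorphy ↔ LevelAvatarAutomorphy :=
  ⟨levelAvatar_of_ta, ta_of_levelAvatar⟩

/-- LA ⟹ TZ (restrict to defect zero). -/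
theorem defectZero_of_levelAvatar (hL : LevelAvatarAutomorphy) : DefectZeroTorsionAutomorphy :=
  fun K _ _ n hcpt hn ι ρ hirr hins hnl hgeo hreg hlvl _ hav => hL K n hcpt hn ι ρ hirr hins hnl hgeo hreg hlvl hav

/-- LA ⟹ TP (restrict to positive defect). -/
theorem positiveDefect_of_levelAvatar (hL : LevelAvatarAutomorphy) : PositiveDefectTorsionAutomorphy :=
  fun K _ _ n hcpt hn ι ρ hirr hins hnl hgeo hreg hlvl _ hav => hL K n hcpt hn ι ρ hirr hins hnl hgeo hreg hlvl hav

/-- TZ ∧ TP ⟹ LA (decide the defect). -/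
theorem levelAvatar_of_cells (hZ : DefectZeroTorsionAutomorphy) (hP : PositiveDefectTorsionAutomorphy) : LevelAvatarAutomorphy := by
  intro K _ _ n hcpt hn ι ρ hirr hins hnl hgeo hreg hlvl hav
  by_cases hd : (n = 2 ∧ NumberField.IsTotallyReal K)
  · exact (defectZeroTorsionAutomorphy_iff.mp hZ) K n hcpt hn ι ρ hirr hins hnl hgeo hreg hlvl hd hav
  · exact (positiveDefectTorsionAutomorphy_iff.mp hP) K n hcpt hn ι ρ hirr hins hnl hgeo hreg hlvl hd hav

/-- LA ⟺ TZ ∧ TP (WEAKER ∧ WEAKER beneath the EQUIV). -/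
theorem levelAvatar_iff_cells : LevelAvatarAutomorphy ↔ (DefectZeroTorsionAutomorphy ∧ PositiveDefectTorsionAutomorphy) :=
  ⟨fun hL => ⟨defectZero_of_levelAvatar hL, positiveDefect_of_levelAvatar hL⟩, fun h => levelAvatar_of_cells h.1 h.2⟩

/-- TA ⟹ TZ. -/
theorem defectZero_of_ta (hT : TorsionAvatarReduction.TorsionAvatarAutomorphy) : DefectZeroTorsionAutomorphy :=
  defectZero_of_levelAvatar (levelAvatar_of_ta hT)

/-- TA ⟹ TP. -/
theorem positiveDefect_of_ta (hT : TorsionAvatarReduction.TorsionAvatarAutomorphy) : PositiveDefectTorsionAutomorphy :=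
  positiveDefect_of_levelAvatar (levelAvatar_of_ta hT)

/-- TZ ∧ TP ⟹ TA — THE REDUCTION: normal form (engine), then decide the defect. -/
theorem ta_of_cells (hZ : DefectZeroTorsionAutomorphy) (hP : PositiveDefectTorsionAutomorphy) : TorsionAvatarReduction.TorsionAvatarAutomorphy :=
  ta_of_levelAvatar (levelAvatar_of_cells hZ hP)

/-- THE EXACT DECOMPOSITION of the node: TA ⟺ TZ ∧ TP. -/
theorem ta_iff_cells : TorsionAvatarReduction.TorsionAvatarAutomorphy ↔ (DefectZeroTorsionAutomorphy ∧ PositiveDefectTorsionAutomorphy) :=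
  ta_iff_levelAvatar.trans levelAvatar_iff_cells

/-- The same decomposition read on the tree twin `Torsion.TorsionAvatarAutomorphy`. -/
theorem ta_twin_iff_cells : Torsion.TorsionAvatarAutomorphy ↔ (DefectZeroTorsionAutomorphy ∧ PositiveDefectTorsionAutomorphy) :=
  ta_iff_cells

/-- FL HOLDS (the support item is a theorem: the engine). [kernel certificate] -/
theorem finiteLevelNormalForm_holds : FiniteLevelNormalForm :=
  fun _ _ _ _ _ hav => hasLevelAvatar_of_hasTorsionAvatar hav

/-! ## KERNEL II — necessity from the summit: Langlands ⟹ TA ⟹ each piece; REG ⟹ cells; the frame from the host -/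

/-- NECESSITY: Langlands ⟹ TA (the born decl; through the landed twin `Torsion.torsionAvatar_of_langlands`). [kernel certificate] -/
theorem ta_of_langlands (hLg : _root_.Langlands) : TorsionAvatarReduction.TorsionAvatarAutomorphy :=
  torsionAvatarAutomorphy_route_iff_twin.mpr (Torsion.torsionAvatar_of_langlands hLg)

/-- NECESSITY: Langlands ⟹ LA. [kernel certificate] -/
theorem levelAvatar_of_langlands (hLg : _root_.Langlands) : LevelAvatarAutomorphy :=
  levelAvatar_of_ta (ta_of_langlands hLg)

/-- NECESSITY: Langlands ⟹ TZ. [kernel certificate] -/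
theorem defectZero_of_langlands (hLg : _root_.Langlands) : DefectZeroTorsionAutomorphy :=
  defectZero_of_ta (ta_of_langlands hLg)

/-- NECESSITY: Langlands ⟹ TP. [kernel certificate] -/
theorem positiveDefect_of_langlands (hLg : _root_.Langlands) : PositiveDefectTorsionAutomorphy :=
  positiveDefect_of_ta (ta_of_langlands hLg)

/-- NECESSITY: Langlands ⟹ FL (trivially: FL is a theorem). [kernel certificate] -/
theorem finiteLevelNormalForm_of_langlands (_ : _root_.Langlands) : FiniteLevelNormalForm :=
  finiteLevelNormalForm_holds

/-- NECESSITY: Langlands ⟹ FRAME⁵ (trivially: a consequence of S used toward S). [kernel certificate] -/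
theorem frame_of_langlands (hLg : _root_.Langlands) : TorsionAvatarFrame := fun _ => hLg

/-- FRAME⁵ from the born host route's two other deciding binders (content certificate: FRAME⁵ = route-Langlands-TorsionAvatarReduction below TA, through its
gate-certified `closes`). -/
theorem frame_of_host (hA : TorsionAvatarReduction.AvatarlessResidueAutomorphy) (hF : TorsionAvatarReduction.RegularResidueFrame) : TorsionAvatarFrame :=
  fun hT => TorsionAvatarReduction.closes hT hA hF

/-- FRAME⁵ from the grand-host route-Langlands-RegularAvatarReduction (AL, NRA 28275, FRAME‴ 28276 via the twin's `Torsion.closes`). -/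
theorem frame_of_grandhost (hA : TorsionAvatarReduction.AvatarlessResidueAutomorphy) (hN : RegularAvatarReduction.NoRegularAvatarAutomorphy)
    (hF : RegularAvatarReduction.NonLiftableResidueFrame) : TorsionAvatarFrame :=
  fun hT => Torsion.closes (torsionAvatarAutomorphy_route_iff_twin.mp hT) (avatarlessResidueAutomorphy_route_iff_twin.mp hA) hN hF

/-- REG 28274 ⟹ TZ ∧ TP (the cells sit below the grand-host crux REG). -/
theorem cells_of_regular (hR : RegularAvatarReduction.RegularNonLiftableAutomorphy) :
    DefectZeroTorsionAutomorphy ∧ PositiveDefectTorsionAutomorphy :=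
  ta_iff_cells.mp (torsionAvatarAutomorphy_route_iff_twin.mpr (Torsion.torsionAvatar_of_regular hR))

/-- NLR 28006 ⟹ TZ ∧ TP. -/
theorem cells_of_nonLiftable (hN : NonLiftableResidueReduction.NonLiftableResidueAutomorphy) :
    DefectZeroTorsionAutomorphy ∧ PositiveDefectTorsionAutomorphy :=
  ta_twin_iff_cells.mp (Torsion.cells_of_nonLiftable hN).1

/-! ## KERNEL III — the lines: TZ ⟸ CAV ∧ ALT (classical avatar, then 2-adic automorphy lifting); TP ⟸ PA ∧ CLS (R = 𝕋 at ℓ = 2, then classicality); rungs -/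

/-- TZ ⟸ CAV ∧ ALT (composition of the BC3 skeleton `line_TZ.lean`): the level avatar yields a CLASSICAL AVATAR σ ≡ ρ mod 𝔪 (torsion vanishing at generic 𝔪 ⇒
torsion-free ⇒ Deligne–Serre ⇒ cuspidal), and a classical avatar in defect zero lifts (2-adic automorphy lifting over totally real K). -/
theorem defectZero_of_classicalAvatar (h1 : ∀ (K : Type) [Field K] [NumberField K] (n : ℕ) (hcpt : Literature.NumberTheory.Automorphic.isCompact_glFiniteIntegralLevel n K), 0 < n → ∀ (ι : PadicAlgCl 2 ≃+* ℂ) (ρ : Literature.NumberTheory.GaloisRepresentations.FramedGaloisRep K (PadicAlgCl 2) n), ρ.toGaloisRep.IsIrreducible → (∀ τ : Field.absoluteGaloisGroup K →* GL (Fin n) (Literature.NumberTheory.GaloisRepresentations.padicAlgClResidueField 2), ρ.IsResidualRepOf (RingHom.id (Literature.NumberTheory.GaloisRepresentations.padicAlgClResidueField 2)) τ → ¬ IsSolvable τ.range) → ¬ (∃ (σ : Literature.NumberTheory.GaloisRepresentations.FramedGaloisRep K (PadicAlgCl 2) n) (τ : Field.absoluteGaloisGroup K →* GL (Fin n) (Literature.NumberTheory.GaloisRepresentations.padicAlgClResidueField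 2)), (Set.range (fun g : Field.absoluteGaloisGroup K => σ g)).Finite ∧ σ.toGaloisRep.IsIrreducible ∧ ρ.IsResidualRepOf (RingHom.id (Literature.NumberTheory.GaloisRepresentations.padicAlgClResidueField 2)) τ ∧ σ.IsResidualRepOf (RingHom.id (Literature.NumberTheory.GaloisRepresentations.padicAlgClResidueField 2)) τ) → ((∀ᶠ v : IsDedekindDomain.HeightOneSpectrum (NumberField.RingOfIntegers K) in cofinite, ρ.IsUnramifiedAt v) ∧ ∀ (v : IsDedekindDomain.HeightOneSpectrum (NumberField.RingOfIntegers K)) (hv : ((2 : ℕ) : NumberField.RingOfIntegers K) ∈ v.asIdeal), (Literature.NumberTheory.PAdicHodge.fontainePstAdicCompletion v 2 hv).IsDeRhamFramed (ρ.toLocal v)) → (∀ (v : IsDedekindDomain.HeightOneSpectrum (NumberField.RingOfIntegers K)) (hv : ((2 : ℕ) : NumberField.RingOfIntegers K) ∈ v.asIdeal), ∀ e : v.adicCompletion K →+* PadicAlgCl 2, Continuous e → (ρ.labelledHodgeTateWeightsAt v (Literature.NumberTheory.PAdicHodge.fontainePstAdicCompletion v 2 hv).algebra (Literature.NumberTheory.PAdicHodge.fontainePstAdicCompletion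 v 2 hv).𝔅 e).Nodup) → (∀ v : IsDedekindDomain.HeightOneSpectrum (NumberField.RingOfIntegers K), ((2 : ℕ) : NumberField.RingOfIntegers K) ∉ v.asIdeal → ρ.IsUnramifiedAt v) → (n = 2 ∧ NumberField.IsTotallyReal K) → (letI : TopologicalSpace (Literature.NumberTheory.GaloisRepresentations.padicAlgClResidueField 2) := ⊥; ∃ (idx : ℕ × ℕ × ℕ) (τ : Literature.NumberTheory.GaloisRepresentations.FramedGaloisRep K (Literature.NumberTheory.GaloisRepresentations.padicAlgClResidueField 2) n), ρ.IsReductionOf (RingHom.id (Literature.NumberTheory.GaloisRepresentations.padicAlgClResidueField 2)) (τ : Field.absoluteGaloisGroup K →* GL (Fin n) (Literature.NumberTheory.GaloisRepresentations.padicAlgClResidueField 2)) ∧ ∃ ψ : (Literature.NumberTheory.Automorphic.BigHeckeGLn.TameLevel.full n K 2).levelHeckeSubring idx →+* Literature.NumberTheory.GaloisRepresentations.padicAlgClResidueField 2, Literature.NumberTheory.Automorphic.BigHeckeGLn.IsAssociatedFamily n (Literature.NumberTheory.Automorphic.BigHeckeGLn.TameLevel.full n K 2).bad (fun v j => ψ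 ((Literature.NumberTheory.Automorphic.BigHeckeGLn.TameLevel.full n K 2).levelHeckeT idx v j)) τ) → (∃ (σ : Literature.NumberTheory.GaloisRepresentations.FramedGaloisRep K (PadicAlgCl 2) n) (τ : Field.absoluteGaloisGroup K →* GL (Fin n) (Literature.NumberTheory.GaloisRepresentations.padicAlgClResidueField 2)), ρ.IsReductionOf (RingHom.id (Literature.NumberTheory.GaloisRepresentations.padicAlgClResidueField 2)) τ ∧ σ.IsReductionOf (RingHom.id (Literature.NumberTheory.GaloisRepresentations.padicAlgClResidueField 2)) τ ∧ (∃ π : Literature.NumberTheory.Automorphic.CuspidalAutomorphicRepData n K hcpt, π.1.IsLAlgebraic ∧ ∀ᶠ v : IsDedekindDomain.HeightOneSpectrum (NumberField.RingOfIntegers K) in cofinite, σ.IsUnramifiedAt v ∧ (∃ α : Multiset ℂ, π.1.HasSatakeParamAt v α) ∧ ∀ α : Multiset ℂ, π.1.HasSatakeParamAt v α → ∃ P Q : Polynomial (Valued.v : Valuation (PadicAlgCl 2) NNReal).valuationSubring, σ.HasFrobCharpolyAt v (P.map (Valued.v : Valuation (PadicAlgCl 2) NNReal).valuationSubring.subtype)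 ∧ Literature.NumberTheory.Automorphic.arithFrobPolyOfSatake ι v.residueCard 1 α = Q.map (Valued.v : Valuation (PadicAlgCl 2) NNReal).valuationSubring.subtype ∧ P.map (IsLocalRing.residue (Valued.v : Valuation (PadicAlgCl 2) NNReal).valuationSubring) = Q.map (IsLocalRing.residue (Valued.v : Valuation (PadicAlgCl 2) NNReal).valuationSubring)))) (h2 : ∀ (K : Type) [Field K] [NumberField K] (n : ℕ) (hcpt : Literature.NumberTheory.Automorphic.isCompact_glFiniteIntegralLevel n K), 0 < n → ∀ (ι : PadicAlgCl 2 ≃+* ℂ) (ρ : Literature.NumberTheory.GaloisRepresentations.FramedGaloisRep K (PadicAlgCl 2) n), ρ.toGaloisRep.IsIrreducible → (∀ τ : Field.absoluteGaloisGroup K →* GL (Fin n) (Literature.NumberTheory.GaloisRepresentations.padicAlgClResidueField 2), ρ.IsResidualRepOf (RingHom.id (Literature.NumberTheory.GaloisRepresentations.padicAlgClResidueField 2)) τ → ¬ IsSolvable τ.range) → ¬ (∃ (σ : Literature.NumberTheory.GaloisRepresentations.FramedGaloisRep K (PadicAlgCl 2) n) (τ : Field.absoluteGaloisGroup K →* GL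 (Fin n) (Literature.NumberTheory.GaloisRepresentations.padicAlgClResidueField 2)), (Set.range (fun g : Field.absoluteGaloisGroup K => σ g)).Finite ∧ σ.toGaloisRep.IsIrreducible ∧ ρ.IsResidualRepOf (RingHom.id (Literature.NumberTheory.GaloisRepresentations.padicAlgClResidueField 2)) τ ∧ σ.IsResidualRepOf (RingHom.id (Literature.NumberTheory.GaloisRepresentations.padicAlgClResidueField 2)) τ) → ((∀ᶠ v : IsDedekindDomain.HeightOneSpectrum (NumberField.RingOfIntegers K) in cofinite, ρ.IsUnramifiedAt v) ∧ ∀ (v : IsDedekindDomain.HeightOneSpectrum (NumberField.RingOfIntegers K)) (hv : ((2 : ℕ) : NumberField.RingOfIntegers K) ∈ v.asIdeal), (Literature.NumberTheory.PAdicHodge.fontainePstAdicCompletion v 2 hv).IsDeRhamFramed (ρ.toLocal v)) → (∀ (v : IsDedekindDomain.HeightOneSpectrum (NumberField.RingOfIntegers K)) (hv : ((2 : ℕ) : NumberField.RingOfIntegers K) ∈ v.asIdeal), ∀ e : v.adicCompletion K →+* PadicAlgCl 2, Continuous e → (ρ.labelledHodgeTateWeightsAt v (Literature.NumberTheory.PAdicHodge.fontainePstAdicCompletion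 v 2 hv).algebra (Literature.NumberTheory.PAdicHodge.fontainePstAdicCompletion v 2 hv).𝔅 e).Nodup) → (∀ v : IsDedekindDomain.HeightOneSpectrum (NumberField.RingOfIntegers K), ((2 : ℕ) : NumberField.RingOfIntegers K) ∉ v.asIdeal → ρ.IsUnramifiedAt v) → (n = 2 ∧ NumberField.IsTotallyReal K) → (∃ (σ : Literature.NumberTheory.GaloisRepresentations.FramedGaloisRep K (PadicAlgCl 2) n) (τ : Field.absoluteGaloisGroup K →* GL (Fin n) (Literature.NumberTheory.GaloisRepresentations.padicAlgClResidueField 2)), ρ.IsReductionOf (RingHom.id (Literature.NumberTheory.GaloisRepresentations.padicAlgClResidueField 2)) τ ∧ σ.IsReductionOf (RingHom.id (Literature.NumberTheory.GaloisRepresentations.padicAlgClResidueField 2)) τ ∧ (∃ π : Literature.NumberTheory.Automorphic.CuspidalAutomorphicRepData n K hcpt, π.1.IsLAlgebraic ∧ ∀ᶠ v : IsDedekindDomain.HeightOneSpectrum (NumberField.RingOfIntegers K) in cofinite, σ.IsUnramifiedAt v ∧ (∃ α : Multiset ℂ, π.1.HasSatakeParamAt v α) ∧ ∀ α : Multiset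 ℂ, π.1.HasSatakeParamAt v α → ∃ P Q : Polynomial (Valued.v : Valuation (PadicAlgCl 2) NNReal).valuationSubring, σ.HasFrobCharpolyAt v (P.map (Valued.v : Valuation (PadicAlgCl 2) NNReal).valuationSubring.subtype) ∧ Literature.NumberTheory.Automorphic.arithFrobPolyOfSatake ι v.residueCard 1 α = Q.map (Valued.v : Valuation (PadicAlgCl 2) NNReal).valuationSubring.subtype ∧ P.map (IsLocalRing.residue (Valued.v : Valuation (PadicAlgCl 2) NNReal).valuationSubring) = Q.map (IsLocalRing.residue (Valued.v : Valuation (PadicAlgCl 2) NNReal).valuationSubring))) → ∃ π : Literature.NumberTheory.Automorphic.CuspidalAutomorphicRepData n K hcpt, π.1.IsLAlgebraic ∧ ∀ᶠ v : IsDedekindDomain.HeightOneSpectrum (NumberField.RingOfIntegers K) in cofinite, ρ.IsUnramifiedAt v ∧ (∃ α : Multiset ℂ, π.1.HasSatakeParamAt v α) ∧ ∀ α : Multiset ℂ, π.1.HasSatakeParamAt v α → ∃ P Q : Polynomial (Valued.v : Valuation (PadicAlgCl 2) NNReal).valuationSubring, ρ.HasFrobCharpolyAt v (P.map (Valued.v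 : Valuation (PadicAlgCl 2) NNReal).valuationSubring.subtype) ∧ Literature.NumberTheory.Automorphic.arithFrobPolyOfSatake ι v.residueCard 1 α = Q.map (Valued.v : Valuation (PadicAlgCl 2) NNReal).valuationSubring.subtype ∧ P.map (IsLocalRing.residue (Valued.v : Valuation (PadicAlgCl 2) NNReal).valuationSubring) = Q.map (IsLocalRing.residue (Valued.v : Valuation (PadicAlgCl 2) NNReal).valuationSubring)) : DefectZeroTorsionAutomorphy :=
  fun K _ _ n hcpt hn ι ρ hirr hins hnl hgeo hreg hlvl hd hav =>
    h2 K n hcpt hn ι ρ hirr hins hnl hgeo hreg hlvl hd (h1 K n hcpt hn ι ρ hirr hins hnl hgeo hreg hlvl hd hav)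

/-- TP ⟸ PA ∧ CLS (composition of the birth skeleton `birth_TP.lean`): the level avatar makes ρ 2-ADICALLY AUTOMORPHIC of tame level one (Calegari–Geraghty
R = 𝕋 at ℓ = 2: the load-bearing, NOT S-implied-in-tree stub), and a de Rham HT-regular 2-adically automorphic ρ is classical. -/
theorem positiveDefect_of_padicAutomorphy (h1 : ∀ (K : Type) [Field K] [NumberField K] (n : ℕ) (hcpt : Literature.NumberTheory.Automorphic.isCompact_glFiniteIntegralLevel n K), 0 < n → ∀ (ι : PadicAlgCl 2 ≃+* ℂ) (ρ : Literature.NumberTheory.GaloisRepresentations.FramedGaloisRep K (PadicAlgCl 2) n), ρ.toGaloisRep.IsIrreducible → (∀ τ : Field.absoluteGaloisGroup K →* GL (Fin n) (Literature.NumberTheory.GaloisRepresentations.padicAlgClResidueField 2), ρ.IsResidualRepOf (RingHom.id (Literature.NumberTheory.GaloisRepresentations.padicAlgClResidueField 2)) τ → ¬ IsSolvable τ.range) → ¬ (∃ (σ : Literature.NumberTheory.GaloisRepresentations.FramedGaloisRep K (PadicAlgCl 2) n) (τ : Field.absoluteGaloisGroup K →* GL (Fin n) (Literature.NumberTheory.GaloisRepresentations.padicAlgClResidueField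 2)), (Set.range (fun g : Field.absoluteGaloisGroup K => σ g)).Finite ∧ σ.toGaloisRep.IsIrreducible ∧ ρ.IsResidualRepOf (RingHom.id (Literature.NumberTheory.GaloisRepresentations.padicAlgClResidueField 2)) τ ∧ σ.IsResidualRepOf (RingHom.id (Literature.NumberTheory.GaloisRepresentations.padicAlgClResidueField 2)) τ) → ((∀ᶠ v : IsDedekindDomain.HeightOneSpectrum (NumberField.RingOfIntegers K) in cofinite, ρ.IsUnramifiedAt v) ∧ ∀ (v : IsDedekindDomain.HeightOneSpectrum (NumberField.RingOfIntegers K)) (hv : ((2 : ℕ) : NumberField.RingOfIntegers K) ∈ v.asIdeal), (Literature.NumberTheory.PAdicHodge.fontainePstAdicCompletion v 2 hv).IsDeRhamFramed (ρ.toLocal v)) → (∀ (v : IsDedekindDomain.HeightOneSpectrum (NumberField.RingOfIntegers K)) (hv : ((2 : ℕ) : NumberField.RingOfIntegers K) ∈ v.asIdeal), ∀ e : v.adicCompletion K →+* PadicAlgCl 2, Continuous e → (ρ.labelledHodgeTateWeightsAt v (Literature.NumberTheory.PAdicHodge.fontainePstAdicCompletion v 2 hv).algebra (Literature.NumberTheory.PAdicHodge.fontainePstAdicCompletion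 v 2 hv).𝔅 e).Nodup) → (∀ v : IsDedekindDomain.HeightOneSpectrum (NumberField.RingOfIntegers K), ((2 : ℕ) : NumberField.RingOfIntegers K) ∉ v.asIdeal → ρ.IsUnramifiedAt v) → ¬ (n = 2 ∧ NumberField.IsTotallyReal K) → (letI : TopologicalSpace (Literature.NumberTheory.GaloisRepresentations.padicAlgClResidueField 2) := ⊥; ∃ (idx : ℕ × ℕ × ℕ) (τ : Literature.NumberTheory.GaloisRepresentations.FramedGaloisRep K (Literature.NumberTheory.GaloisRepresentations.padicAlgClResidueField 2) n), ρ.IsReductionOf (RingHom.id (Literature.NumberTheory.GaloisRepresentations.padicAlgClResidueField 2)) (τ : Field.absoluteGaloisGroup K →* GL (Fin n) (Literature.NumberTheory.GaloisRepresentations.padicAlgClResidueField 2)) ∧ ∃ ψ : (Literature.NumberTheory.Automorphic.BigHeckeGLn.TameLevel.full n K 2).levelHeckeSubring idx →+* Literature.NumberTheory.GaloisRepresentations.padicAlgClResidueField 2, Literature.NumberTheory.Automorphic.BigHeckeGLn.IsAssociatedFamily n (Literature.NumberTheory.Automorphic.BigHeckeGLn.TameLevel.full n K 2).bad (fun v j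 => ψ ((Literature.NumberTheory.Automorphic.BigHeckeGLn.TameLevel.full n K 2).levelHeckeT idx v j)) τ) → (Literature.NumberTheory.Automorphic.BigHeckeGLn.TameLevel.full n K 2).IsPadicallyAutomorphic ρ) (h2 : ∀ (K : Type) [Field K] [NumberField K] (n : ℕ) (hcpt : Literature.NumberTheory.Automorphic.isCompact_glFiniteIntegralLevel n K), 0 < n → ∀ (ι : PadicAlgCl 2 ≃+* ℂ) (ρ : Literature.NumberTheory.GaloisRepresentations.FramedGaloisRep K (PadicAlgCl 2) n), ρ.toGaloisRep.IsIrreducible → (∀ τ : Field.absoluteGaloisGroup K →* GL (Fin n) (Literature.NumberTheory.GaloisRepresentations.padicAlgClResidueField 2), ρ.IsResidualRepOf (RingHom.id (Literature.NumberTheory.GaloisRepresentations.padicAlgClResidueField 2)) τ → ¬ IsSolvable τ.range) → ¬ (∃ (σ : Literature.NumberTheory.GaloisRepresentations.FramedGaloisRep K (PadicAlgCl 2) n) (τ : Field.absoluteGaloisGroup K →* GL (Fin n) (Literature.NumberTheory.GaloisRepresentations.padicAlgClResidueField 2)), (Set.range (fun g : Field.absoluteGaloisGroup K => σ g)).Finite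 ∧ σ.toGaloisRep.IsIrreducible ∧ ρ.IsResidualRepOf (RingHom.id (Literature.NumberTheory.GaloisRepresentations.padicAlgClResidueField 2)) τ ∧ σ.IsResidualRepOf (RingHom.id (Literature.NumberTheory.GaloisRepresentations.padicAlgClResidueField 2)) τ) → ((∀ᶠ v : IsDedekindDomain.HeightOneSpectrum (NumberField.RingOfIntegers K) in cofinite, ρ.IsUnramifiedAt v) ∧ ∀ (v : IsDedekindDomain.HeightOneSpectrum (NumberField.RingOfIntegers K)) (hv : ((2 : ℕ) : NumberField.RingOfIntegers K) ∈ v.asIdeal), (Literature.NumberTheory.PAdicHodge.fontainePstAdicCompletion v 2 hv).IsDeRhamFramed (ρ.toLocal v)) → (∀ (v : IsDedekindDomain.HeightOneSpectrum (NumberField.RingOfIntegers K)) (hv : ((2 : ℕ) : NumberField.RingOfIntegers K) ∈ v.asIdeal), ∀ e : v.adicCompletion K →+* PadicAlgCl 2, Continuous e → (ρ.labelledHodgeTateWeightsAt v (Literature.NumberTheory.PAdicHodge.fontainePstAdicCompletion v 2 hv).algebra (Literature.NumberTheory.PAdicHodge.fontainePstAdicCompletion v 2 hv).𝔅 e).Nodup)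 → (∀ v : IsDedekindDomain.HeightOneSpectrum (NumberField.RingOfIntegers K), ((2 : ℕ) : NumberField.RingOfIntegers K) ∉ v.asIdeal → ρ.IsUnramifiedAt v) → ¬ (n = 2 ∧ NumberField.IsTotallyReal K) → (Literature.NumberTheory.Automorphic.BigHeckeGLn.TameLevel.full n K 2).IsPadicallyAutomorphic ρ → ∃ π : Literature.NumberTheory.Automorphic.CuspidalAutomorphicRepData n K hcpt, π.1.IsLAlgebraic ∧ ∀ᶠ v : IsDedekindDomain.HeightOneSpectrum (NumberField.RingOfIntegers K) in cofinite, ρ.IsUnramifiedAt v ∧ (∃ α : Multiset ℂ, π.1.HasSatakeParamAt v α) ∧ ∀ α : Multiset ℂ, π.1.HasSatakeParamAt v α → ∃ P Q : Polynomial (Valued.v : Valuation (PadicAlgCl 2) NNReal).valuationSubring, ρ.HasFrobCharpolyAt v (P.map (Valued.v : Valuation (PadicAlgCl 2) NNReal).valuationSubring.subtype) ∧ Literature.NumberTheory.Automorphic.arithFrobPolyOfSatake ι v.residueCard 1 α = Q.map (Valued.v : Valuation (PadicAlgCl 2) NNReal).valuationSubring.subtype ∧ P.map (IsLocalRing.residue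 (Valued.v : Valuation (PadicAlgCl 2) NNReal).valuationSubring) = Q.map (IsLocalRing.residue (Valued.v : Valuation (PadicAlgCl 2) NNReal).valuationSubring)) : PositiveDefectTorsionAutomorphy :=
  fun K _ _ n hcpt hn ι ρ hirr hins hnl hgeo hreg hlvl hd hav =>
    h2 K n hcpt hn ι ρ hirr hins hnl hgeo hreg hlvl hd (h1 K n hcpt hn ι ρ hirr hins hnl hgeo hreg hlvl hd hav)

/-- The CAV stub, the ALT stub and the CLS stub are S-implied (their content is TZ/TP-restricted automorphy; for CAV the classical avatar of an automorphic ρ is ρ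
itself, sharing any of its reductions — `Torsion.exists_isReductionOf`). [kernel certificate] -/
theorem lineStubs_of_langlands (hLg : _root_.Langlands) : (∀ (K : Type) [Field K] [NumberField K] (n : ℕ) (hcpt : Literature.NumberTheory.Automorphic.isCompact_glFiniteIntegralLevel n K), 0 < n → ∀ (ι : PadicAlgCl 2 ≃+* ℂ) (ρ : Literature.NumberTheory.GaloisRepresentations.FramedGaloisRep K (PadicAlgCl 2) n), ρ.toGaloisRep.IsIrreducible → (∀ τ : Field.absoluteGaloisGroup K →* GL (Fin n) (Literature.NumberTheory.GaloisRepresentations.padicAlgClResidueField 2), ρ.IsResidualRepOf (RingHom.id (Literature.NumberTheory.GaloisRepresentations.padicAlgClResidueField 2)) τ → ¬ IsSolvable τ.range) → ¬ (∃ (σ : Literature.NumberTheory.GaloisRepresentations.FramedGaloisRep K (PadicAlgCl 2) n) (τ : Field.absoluteGaloisGroup K →* GL (Fin n) (Literature.NumberTheory.GaloisRepresentations.padicAlgClResidueField 2)), (Set.range (fun g : Field.absoluteGaloisGroup K => σ g)).Finite ∧ σ.toGaloisRep.IsIrreducible ∧ ρ.IsResidualRepOf (RingHom.id (Literature.NumberTheory.GaloisRepresentations.padicAlgClResidueField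 2)) τ ∧ σ.IsResidualRepOf (RingHom.id (Literature.NumberTheory.GaloisRepresentations.padicAlgClResidueField 2)) τ) → ((∀ᶠ v : IsDedekindDomain.HeightOneSpectrum (NumberField.RingOfIntegers K) in cofinite, ρ.IsUnramifiedAt v) ∧ ∀ (v : IsDedekindDomain.HeightOneSpectrum (NumberField.RingOfIntegers K)) (hv : ((2 : ℕ) : NumberField.RingOfIntegers K) ∈ v.asIdeal), (Literature.NumberTheory.PAdicHodge.fontainePstAdicCompletion v 2 hv).IsDeRhamFramed (ρ.toLocal v)) → (∀ (v : IsDedekindDomain.HeightOneSpectrum (NumberField.RingOfIntegers K)) (hv : ((2 : ℕ) : NumberField.RingOfIntegers K) ∈ v.asIdeal), ∀ e : v.adicCompletion K →+* PadicAlgCl 2, Continuous e → (ρ.labelledHodgeTateWeightsAt v (Literature.NumberTheory.PAdicHodge.fontainePstAdicCompletion v 2 hv).algebra (Literature.NumberTheory.PAdicHodge.fontainePstAdicCompletion v 2 hv).𝔅 e).Nodup) → (∀ v : IsDedekindDomain.HeightOneSpectrum (NumberField.RingOfIntegers K), ((2 : ℕ) : NumberField.RingOfIntegers K) ∉ v.asIdeal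 → ρ.IsUnramifiedAt v) → (n = 2 ∧ NumberField.IsTotallyReal K) → (letI : TopologicalSpace (Literature.NumberTheory.GaloisRepresentations.padicAlgClResidueField 2) := ⊥; ∃ (idx : ℕ × ℕ × ℕ) (τ : Literature.NumberTheory.GaloisRepresentations.FramedGaloisRep K (Literature.NumberTheory.GaloisRepresentations.padicAlgClResidueField 2) n), ρ.IsReductionOf (RingHom.id (Literature.NumberTheory.GaloisRepresentations.padicAlgClResidueField 2)) (τ : Field.absoluteGaloisGroup K →* GL (Fin n) (Literature.NumberTheory.GaloisRepresentations.padicAlgClResidueField 2)) ∧ ∃ ψ : (Literature.NumberTheory.Automorphic.BigHeckeGLn.TameLevel.full n K 2).levelHeckeSubring idx →+* Literature.NumberTheory.GaloisRepresentations.padicAlgClResidueField 2, Literature.NumberTheory.Automorphic.BigHeckeGLn.IsAssociatedFamily n (Literature.NumberTheory.Automorphic.BigHeckeGLn.TameLevel.full n K 2).bad (fun v j => ψ ((Literature.NumberTheory.Automorphic.BigHeckeGLn.TameLevel.full n K 2).levelHeckeT idx v j)) τ) → (∃ (σ : Literature.NumberTheory.GaloisRepresentations.FramedGaloisRep K (PadicAlgCl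 2) n) (τ : Field.absoluteGaloisGroup K →* GL (Fin n) (Literature.NumberTheory.GaloisRepresentations.padicAlgClResidueField 2)), ρ.IsReductionOf (RingHom.id (Literature.NumberTheory.GaloisRepresentations.padicAlgClResidueField 2)) τ ∧ σ.IsReductionOf (RingHom.id (Literature.NumberTheory.GaloisRepresentations.padicAlgClResidueField 2)) τ ∧ (∃ π : Literature.NumberTheory.Automorphic.CuspidalAutomorphicRepData n K hcpt, π.1.IsLAlgebraic ∧ ∀ᶠ v : IsDedekindDomain.HeightOneSpectrum (NumberField.RingOfIntegers K) in cofinite, σ.IsUnramifiedAt v ∧ (∃ α : Multiset ℂ, π.1.HasSatakeParamAt v α) ∧ ∀ α : Multiset ℂ, π.1.HasSatakeParamAt v α → ∃ P Q : Polynomial (Valued.v : Valuation (PadicAlgCl 2) NNReal).valuationSubring, σ.HasFrobCharpolyAt v (P.map (Valued.v : Valuation (PadicAlgCl 2) NNReal).valuationSubring.subtype) ∧ Literature.NumberTheory.Automorphic.arithFrobPolyOfSatake ι v.residueCard 1 α = Q.map (Valued.v : Valuation (PadicAlgCl 2) NNReal).valuationSubring.subtype ∧ P.map (IsLocalRing.residue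 (Valued.v : Valuation (PadicAlgCl 2) NNReal).valuationSubring) = Q.map (IsLocalRing.residue (Valued.v : Valuation (PadicAlgCl 2) NNReal).valuationSubring)))) ∧ (∀ (K : Type) [Field K] [NumberField K] (n : ℕ) (hcpt : Literature.NumberTheory.Automorphic.isCompact_glFiniteIntegralLevel n K), 0 < n → ∀ (ι : PadicAlgCl 2 ≃+* ℂ) (ρ : Literature.NumberTheory.GaloisRepresentations.FramedGaloisRep K (PadicAlgCl 2) n), ρ.toGaloisRep.IsIrreducible → (∀ τ : Field.absoluteGaloisGroup K →* GL (Fin n) (Literature.NumberTheory.GaloisRepresentations.padicAlgClResidueField 2), ρ.IsResidualRepOf (RingHom.id (Literature.NumberTheory.GaloisRepresentations.padicAlgClResidueField 2)) τ → ¬ IsSolvable τ.range) → ¬ (∃ (σ : Literature.NumberTheory.GaloisRepresentations.FramedGaloisRep K (PadicAlgCl 2) n) (τ : Field.absoluteGaloisGroup K →* GL (Fin n) (Literature.NumberTheory.GaloisRepresentations.padicAlgClResidueField 2)), (Set.range (fun g : Field.absoluteGaloisGroup K => σ g)).Finite ∧ σ.toGaloisRep.IsIrreducible ∧ ρ.IsResidualRepOf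 (RingHom.id (Literature.NumberTheory.GaloisRepresentations.padicAlgClResidueField 2)) τ ∧ σ.IsResidualRepOf (RingHom.id (Literature.NumberTheory.GaloisRepresentations.padicAlgClResidueField 2)) τ) → ((∀ᶠ v : IsDedekindDomain.HeightOneSpectrum (NumberField.RingOfIntegers K) in cofinite, ρ.IsUnramifiedAt v) ∧ ∀ (v : IsDedekindDomain.HeightOneSpectrum (NumberField.RingOfIntegers K)) (hv : ((2 : ℕ) : NumberField.RingOfIntegers K) ∈ v.asIdeal), (Literature.NumberTheory.PAdicHodge.fontainePstAdicCompletion v 2 hv).IsDeRhamFramed (ρ.toLocal v)) → (∀ (v : IsDedekindDomain.HeightOneSpectrum (NumberField.RingOfIntegers K)) (hv : ((2 : ℕ) : NumberField.RingOfIntegers K) ∈ v.asIdeal), ∀ e : v.adicCompletion K →+* PadicAlgCl 2, Continuous e → (ρ.labelledHodgeTateWeightsAt v (Literature.NumberTheory.PAdicHodge.fontainePstAdicCompletion v 2 hv).algebra (Literature.NumberTheory.PAdicHodge.fontainePstAdicCompletion v 2 hv).𝔅 e).Nodup) → (∀ v : IsDedekindDomain.HeightOneSpectrum (NumberField.RingOfIntegers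 K), ((2 : ℕ) : NumberField.RingOfIntegers K) ∉ v.asIdeal → ρ.IsUnramifiedAt v) → (n = 2 ∧ NumberField.IsTotallyReal K) → (∃ (σ : Literature.NumberTheory.GaloisRepresentations.FramedGaloisRep K (PadicAlgCl 2) n) (τ : Field.absoluteGaloisGroup K →* GL (Fin n) (Literature.NumberTheory.GaloisRepresentations.padicAlgClResidueField 2)), ρ.IsReductionOf (RingHom.id (Literature.NumberTheory.GaloisRepresentations.padicAlgClResidueField 2)) τ ∧ σ.IsReductionOf (RingHom.id (Literature.NumberTheory.GaloisRepresentations.padicAlgClResidueField 2)) τ ∧ (∃ π : Literature.NumberTheory.Automorphic.CuspidalAutomorphicRepData n K hcpt, π.1.IsLAlgebraic ∧ ∀ᶠ v : IsDedekindDomain.HeightOneSpectrum (NumberField.RingOfIntegers K) in cofinite, σ.IsUnramifiedAt v ∧ (∃ α : Multiset ℂ, π.1.HasSatakeParamAt v α) ∧ ∀ α : Multiset ℂ, π.1.HasSatakeParamAt v α → ∃ P Q : Polynomial (Valued.v : Valuation (PadicAlgCl 2) NNReal).valuationSubring, σ.HasFrobCharpolyAt v (P.map (Valued.v : Valuation (PadicAlgCl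 2) NNReal).valuationSubring.subtype) ∧ Literature.NumberTheory.Automorphic.arithFrobPolyOfSatake ι v.residueCard 1 α = Q.map (Valued.v : Valuation (PadicAlgCl 2) NNReal).valuationSubring.subtype ∧ P.map (IsLocalRing.residue (Valued.v : Valuation (PadicAlgCl 2) NNReal).valuationSubring) = Q.map (IsLocalRing.residue (Valued.v : Valuation (PadicAlgCl 2) NNReal).valuationSubring))) → ∃ π : Literature.NumberTheory.Automorphic.CuspidalAutomorphicRepData n K hcpt, π.1.IsLAlgebraic ∧ ∀ᶠ v : IsDedekindDomain.HeightOneSpectrum (NumberField.RingOfIntegers K) in cofinite, ρ.IsUnramifiedAt v ∧ (∃ α : Multiset ℂ, π.1.HasSatakeParamAt v α) ∧ ∀ α : Multiset ℂ, π.1.HasSatakeParamAt v α → ∃ P Q : Polynomial (Valued.v : Valuation (PadicAlgCl 2) NNReal).valuationSubring, ρ.HasFrobCharpolyAt v (P.map (Valued.v : Valuation (PadicAlgCl 2) NNReal).valuationSubring.subtype) ∧ Literature.NumberTheory.Automorphic.arithFrobPolyOfSatake ι v.residueCard 1 α = Q.map (Valued.v : Valuation (PadicAlgCl 2) NNReal).valuationSubring.subtype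 ∧ P.map (IsLocalRing.residue (Valued.v : Valuation (PadicAlgCl 2) NNReal).valuationSubring) = Q.map (IsLocalRing.residue (Valued.v : Valuation (PadicAlgCl 2) NNReal).valuationSubring)) ∧ (∀ (K : Type) [Field K] [NumberField K] (n : ℕ) (hcpt : Literature.NumberTheory.Automorphic.isCompact_glFiniteIntegralLevel n K), 0 < n → ∀ (ι : PadicAlgCl 2 ≃+* ℂ) (ρ : Literature.NumberTheory.GaloisRepresentations.FramedGaloisRep K (PadicAlgCl 2) n), ρ.toGaloisRep.IsIrreducible → (∀ τ : Field.absoluteGaloisGroup K →* GL (Fin n) (Literature.NumberTheory.GaloisRepresentations.padicAlgClResidueField 2), ρ.IsResidualRepOf (RingHom.id (Literature.NumberTheory.GaloisRepresentations.padicAlgClResidueField 2)) τ → ¬ IsSolvable τ.range) → ¬ (∃ (σ : Literature.NumberTheory.GaloisRepresentations.FramedGaloisRep K (PadicAlgCl 2) n) (τ : Field.absoluteGaloisGroup K →* GL (Fin n) (Literature.NumberTheory.GaloisRepresentations.padicAlgClResidueField 2)), (Set.range (fun g : Field.absoluteGaloisGroup K => σ g)).Finite ∧ σ.toGaloisRep.IsIrreducible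 ∧ ρ.IsResidualRepOf (RingHom.id (Literature.NumberTheory.GaloisRepresentations.padicAlgClResidueField 2)) τ ∧ σ.IsResidualRepOf (RingHom.id (Literature.NumberTheory.GaloisRepresentations.padicAlgClResidueField 2)) τ) → ((∀ᶠ v : IsDedekindDomain.HeightOneSpectrum (NumberField.RingOfIntegers K) in cofinite, ρ.IsUnramifiedAt v) ∧ ∀ (v : IsDedekindDomain.HeightOneSpectrum (NumberField.RingOfIntegers K)) (hv : ((2 : ℕ) : NumberField.RingOfIntegers K) ∈ v.asIdeal), (Literature.NumberTheory.PAdicHodge.fontainePstAdicCompletion v 2 hv).IsDeRhamFramed (ρ.toLocal v)) → (∀ (v : IsDedekindDomain.HeightOneSpectrum (NumberField.RingOfIntegers K)) (hv : ((2 : ℕ) : NumberField.RingOfIntegers K) ∈ v.asIdeal), ∀ e : v.adicCompletion K →+* PadicAlgCl 2, Continuous e → (ρ.labelledHodgeTateWeightsAt v (Literature.NumberTheory.PAdicHodge.fontainePstAdicCompletion v 2 hv).algebra (Literature.NumberTheory.PAdicHodge.fontainePstAdicCompletion v 2 hv).𝔅 e).Nodup) → (∀ v : IsDedekindDomain.HeightOneSpectrum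 (NumberField.RingOfIntegers K), ((2 : ℕ) : NumberField.RingOfIntegers K) ∉ v.asIdeal → ρ.IsUnramifiedAt v) → ¬ (n = 2 ∧ NumberField.IsTotallyReal K) → (Literature.NumberTheory.Automorphic.BigHeckeGLn.TameLevel.full n K 2).IsPadicallyAutomorphic ρ → ∃ π : Literature.NumberTheory.Automorphic.CuspidalAutomorphicRepData n K hcpt, π.1.IsLAlgebraic ∧ ∀ᶠ v : IsDedekindDomain.HeightOneSpectrum (NumberField.RingOfIntegers K) in cofinite, ρ.IsUnramifiedAt v ∧ (∃ α : Multiset ℂ, π.1.HasSatakeParamAt v α) ∧ ∀ α : Multiset ℂ, π.1.HasSatakeParamAt v α → ∃ P Q : Polynomial (Valued.v : Valuation (PadicAlgCl 2) NNReal).valuationSubring, ρ.HasFrobCharpolyAt v (P.map (Valued.v : Valuation (PadicAlgCl 2) NNReal).valuationSubring.subtype) ∧ Literature.NumberTheory.Automorphic.arithFrobPolyOfSatake ι v.residueCard 1 α = Q.map (Valued.v : Valuation (PadicAlgCl 2) NNReal).valuationSubring.subtype ∧ P.map (IsLocalRing.residue (Valued.v : Valuation (PadicAlgCl 2) NNReal).valuationSubring)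 = Q.map (IsLocalRing.residue (Valued.v : Valuation (PadicAlgCl 2) NNReal).valuationSubring)) := by
  have hR := Torsion.regular_of_langlands hLg
  refine ⟨fun K _ _ n hcpt hn ι ρ hirr hins hnl hgeo hreg hlvl _ _ => ?_,
    fun K _ _ n hcpt hn ι ρ hirr hins hnl hgeo hreg hlvl _ _ => hR K n hcpt hn ι ρ hirr hins hnl hgeo hreg hlvl,
    fun K _ _ n hcpt hn ι ρ hirr hins hnl hgeo hreg hlvl _ _ => hR K n hcpt hn ι ρ hirr hins hnl hgeo hreg hlvl⟩
  obtain ⟨τ, hτ⟩ := Torsion.exists_isReductionOf ρ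
  exact ⟨ρ, τ, hτ, hτ, hR K n hcpt hn ι ρ hirr hins hnl hgeo hreg hlvl⟩

/-- TZ ⟹ its rung (depth r = 0: the avatar occurs at level U_0 = GL₂(𝒪̂_K) itself, n = 2, K totally real — Dembélé's level-one sector). [kernel certificate] -/
theorem rung_of_defectZero (hZ : DefectZeroTorsionAutomorphy) : ∀ (K : Type) [Field K] [NumberField K] [NumberField.IsTotallyReal K] (hcpt : Literature.NumberTheory.Automorphic.isCompact_glFiniteIntegralLevel 2 K) (ι : PadicAlgCl 2 ≃+* ℂ) (ρ : Literature.NumberTheory.GaloisRepresentations.FramedGaloisRep K (PadicAlgCl 2) 2), ρ.toGaloisRep.IsIrreducible → (∀ τ : Field.absoluteGaloisGroup K →* GL (Fin 2) (Literature.NumberTheory.GaloisRepresentations.padicAlgClResidueField 2), ρ.IsResidualRepOf (RingHom.id (Literature.NumberTheory.GaloisRepresentations.padicAlgClResidueField 2)) τ → ¬ IsSolvable τ.range) → ¬ (∃ (σ : Literature.NumberTheory.GaloisRepresentations.FramedGaloisRep K (PadicAlgCl 2) 2) (τ : Field.absoluteGaloisGroup K →* GL (Fin 2) (Literature.NumberTheory.GaloisRepresentations.padicAlgClResidueField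 2)), (Set.range (fun g : Field.absoluteGaloisGroup K => σ g)).Finite ∧ σ.toGaloisRep.IsIrreducible ∧ ρ.IsResidualRepOf (RingHom.id (Literature.NumberTheory.GaloisRepresentations.padicAlgClResidueField 2)) τ ∧ σ.IsResidualRepOf (RingHom.id (Literature.NumberTheory.GaloisRepresentations.padicAlgClResidueField 2)) τ) → ((∀ᶠ v : IsDedekindDomain.HeightOneSpectrum (NumberField.RingOfIntegers K) in cofinite, ρ.IsUnramifiedAt v) ∧ ∀ (v : IsDedekindDomain.HeightOneSpectrum (NumberField.RingOfIntegers K)) (hv : ((2 : ℕ) : NumberField.RingOfIntegers K) ∈ v.asIdeal), (Literature.NumberTheory.PAdicHodge.fontainePstAdicCompletion v 2 hv).IsDeRhamFramed (ρ.toLocal v)) → (∀ (v : IsDedekindDomain.HeightOneSpectrum (NumberField.RingOfIntegers K)) (hv : ((2 : ℕ) : NumberField.RingOfIntegers K) ∈ v.asIdeal), ∀ e : v.adicCompletion K →+* PadicAlgCl 2, Continuous e → (ρ.labelledHodgeTateWeightsAt v (Literature.NumberTheory.PAdicHodge.fontainePstAdicCompletion v 2 hv).algebra (Literature.NumberTheory.PAdicHodge.fontainePstAdicCompletion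 v 2 hv).𝔅 e).Nodup) → (∀ v : IsDedekindDomain.HeightOneSpectrum (NumberField.RingOfIntegers K), ((2 : ℕ) : NumberField.RingOfIntegers K) ∉ v.asIdeal → ρ.IsUnramifiedAt v) → (letI : TopologicalSpace (Literature.NumberTheory.GaloisRepresentations.padicAlgClResidueField 2) := ⊥; ∃ (idx : ℕ × ℕ × ℕ) (τ : Literature.NumberTheory.GaloisRepresentations.FramedGaloisRep K (Literature.NumberTheory.GaloisRepresentations.padicAlgClResidueField 2) 2), idx.1 = 0 ∧ ρ.IsReductionOf (RingHom.id (Literature.NumberTheory.GaloisRepresentations.padicAlgClResidueField 2)) (τ : Field.absoluteGaloisGroup K →* GL (Fin 2) (Literature.NumberTheory.GaloisRepresentations.padicAlgClResidueField 2)) ∧ ∃ ψ : (Literature.NumberTheory.Automorphic.BigHeckeGLn.TameLevel.full 2 K 2).levelHeckeSubring idx →+* Literature.NumberTheory.GaloisRepresentations.padicAlgClResidueField 2, Literature.NumberTheory.Automorphic.BigHeckeGLn.IsAssociatedFamily 2 (Literature.NumberTheory.Automorphic.BigHeckeGLn.TameLevel.full 2 K 2).bad (fun v j => ψ ((Literature.NumberTheory.Automorphic.BigHeckeGLn.TameLevel.full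 2 K 2).levelHeckeT idx v j)) τ) → ∃ π : Literature.NumberTheory.Automorphic.CuspidalAutomorphicRepData 2 K hcpt, π.1.IsLAlgebraic ∧ ∀ᶠ v : IsDedekindDomain.HeightOneSpectrum (NumberField.RingOfIntegers K) in cofinite, ρ.IsUnramifiedAt v ∧ (∃ α : Multiset ℂ, π.1.HasSatakeParamAt v α) ∧ ∀ α : Multiset ℂ, π.1.HasSatakeParamAt v α → ∃ P Q : Polynomial (Valued.v : Valuation (PadicAlgCl 2) NNReal).valuationSubring, ρ.HasFrobCharpolyAt v (P.map (Valued.v : Valuation (PadicAlgCl 2) NNReal).valuationSubring.subtype) ∧ Literature.NumberTheory.Automorphic.arithFrobPolyOfSatake ι v.residueCard 1 α = Q.map (Valued.v : Valuation (PadicAlgCl 2) NNReal).valuationSubring.subtype ∧ P.map (IsLocalRing.residue (Valued.v : Valuation (PadicAlgCl 2) NNReal).valuationSubring) = Q.map (IsLocalRing.residue (Valued.v : Valuation (PadicAlgCl 2) NNReal).valuationSubring) := by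
  intro K _ _ _ hcpt ι ρ hirr hins hnl hgeo hreg hlvl hav
  refine hZ K 2 hcpt two_pos ι ρ hirr hins hnl hgeo hreg hlvl ⟨rfl, ‹_›⟩ ?_
  letI : TopologicalSpace (padicAlgClResidueField 2) := ⊥
  obtain ⟨idx, τ, -, hτ, ψ, hψ⟩ := hav
  exact ⟨idx, τ, hτ, ψ, hψ⟩

/-- TP ⟹ its rung (n = 2, K imaginary quadratic: the Bianchi sector, defect 1). [kernel certificate] -/
theorem rung_of_positiveDefect (hP : PositiveDefectTorsionAutomorphy) : ∀ (K : Type) [Field K] [NumberField K], Module.finrank ℚ K = 2 → ¬ NumberField.IsTotallyReal K → ∀ (hcpt : Literature.NumberTheory.Automorphic.isCompact_glFiniteIntegralLevel 2 K) (ι : PadicAlgCl 2 ≃+* ℂ) (ρ : Literature.NumberTheory.GaloisRepresentations.FramedGaloisRep K (PadicAlgCl 2) 2), ρ.toGaloisRep.IsIrreducible → (∀ τ : Field.absoluteGaloisGroup K →* GL (Fin 2) (Literature.NumberTheory.GaloisRepresentations.padicAlgClResidueField 2), ρ.IsResidualRepOf (RingHom.id (Literature.NumberTheory.GaloisRepresentations.padicAlgClResidueField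 2)) τ → ¬ IsSolvable τ.range) → ¬ (∃ (σ : Literature.NumberTheory.GaloisRepresentations.FramedGaloisRep K (PadicAlgCl 2) 2) (τ : Field.absoluteGaloisGroup K →* GL (Fin 2) (Literature.NumberTheory.GaloisRepresentations.padicAlgClResidueField 2)), (Set.range (fun g : Field.absoluteGaloisGroup K => σ g)).Finite ∧ σ.toGaloisRep.IsIrreducible ∧ ρ.IsResidualRepOf (RingHom.id (Literature.NumberTheory.GaloisRepresentations.padicAlgClResidueField 2)) τ ∧ σ.IsResidualRepOf (RingHom.id (Literature.NumberTheory.GaloisRepresentations.padicAlgClResidueField 2)) τ) → ((∀ᶠ v : IsDedekindDomain.HeightOneSpectrum (NumberField.RingOfIntegers K) in cofinite, ρ.IsUnramifiedAt v) ∧ ∀ (v : IsDedekindDomain.HeightOneSpectrum (NumberField.RingOfIntegers K)) (hv : ((2 : ℕ) : NumberField.RingOfIntegers K) ∈ v.asIdeal), (Literature.NumberTheory.PAdicHodge.fontainePstAdicCompletion v 2 hv).IsDeRhamFramed (ρ.toLocal v)) → (∀ (v : IsDedekindDomain.HeightOneSpectrum (NumberField.RingOfIntegers K)) (hv : ((2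 : ℕ) : NumberField.RingOfIntegers K) ∈ v.asIdeal), ∀ e : v.adicCompletion K →+* PadicAlgCl 2, Continuous e → (ρ.labelledHodgeTateWeightsAt v (Literature.NumberTheory.PAdicHodge.fontainePstAdicCompletion v 2 hv).algebra (Literature.NumberTheory.PAdicHodge.fontainePstAdicCompletion v 2 hv).𝔅 e).Nodup) → (∀ v : IsDedekindDomain.HeightOneSpectrum (NumberField.RingOfIntegers K), ((2 : ℕ) : NumberField.RingOfIntegers K) ∉ v.asIdeal → ρ.IsUnramifiedAt v) → (letI : TopologicalSpace (Literature.NumberTheory.GaloisRepresentations.padicAlgClResidueField 2) := ⊥; ∃ (idx : ℕ × ℕ × ℕ) (τ : Literature.NumberTheory.GaloisRepresentations.FramedGaloisRep K (Literature.NumberTheory.GaloisRepresentations.padicAlgClResidueField 2) 2), ρ.IsReductionOf (RingHom.id (Literature.NumberTheory.GaloisRepresentations.padicAlgClResidueField 2)) (τ : Field.absoluteGaloisGroup K →* GL (Fin 2) (Literature.NumberTheory.GaloisRepresentations.padicAlgClResidueField 2)) ∧ ∃ ψ : (Literature.NumberTheory.Automorphic.BigHeckeGLn.TameLevel.full 2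 K 2).levelHeckeSubring idx →+* Literature.NumberTheory.GaloisRepresentations.padicAlgClResidueField 2, Literature.NumberTheory.Automorphic.BigHeckeGLn.IsAssociatedFamily 2 (Literature.NumberTheory.Automorphic.BigHeckeGLn.TameLevel.full 2 K 2).bad (fun v j => ψ ((Literature.NumberTheory.Automorphic.BigHeckeGLn.TameLevel.full 2 K 2).levelHeckeT idx v j)) τ) → ∃ π : Literature.NumberTheory.Automorphic.CuspidalAutomorphicRepData 2 K hcpt, π.1.IsLAlgebraic ∧ ∀ᶠ v : IsDedekindDomain.HeightOneSpectrum (NumberField.RingOfIntegers K) in cofinite, ρ.IsUnramifiedAt v ∧ (∃ α : Multiset ℂ, π.1.HasSatakeParamAt v α) ∧ ∀ α : Multiset ℂ, π.1.HasSatakeParamAt v α → ∃ P Q : Polynomial (Valued.v : Valuation (PadicAlgCl 2) NNReal).valuationSubring, ρ.HasFrobCharpolyAt v (P.map (Valued.v : Valuation (PadicAlgCl 2) NNReal).valuationSubring.subtype) ∧ Literature.NumberTheory.Automorphic.arithFrobPolyOfSatake ι v.residueCard 1 α = Q.map (Valued.v : Valuation (PadicAlgCl 2) NNReal).valuationSubring.subtype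 ∧ P.map (IsLocalRing.residue (Valued.v : Valuation (PadicAlgCl 2) NNReal).valuationSubring) = Q.map (IsLocalRing.residue (Valued.v : Valuation (PadicAlgCl 2) NNReal).valuationSubring) :=
  fun K _ _ _ hK hcpt ι ρ hirr hins hnl hgeo hreg hlvl hav =>
    hP K 2 hcpt two_pos ι ρ hirr hins hnl hgeo hreg hlvl (fun h => hK h.2) hav

/-! ## KERNEL IV — the deciding theorems -/

/-- `closes` of the child route `FiniteLevelTorsionSplit` (four binders: TZ → TP → FL → FRAME⁵ → Langlands) — PURE LOGIC over the texts (the certified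
glue.lean verbatim): FRAME⁵ reduces Langlands to TA; given TA's binders and a torsion avatar, FL turns it into a level avatar, one excluded middle on the
defect dispatches to TZ or TP. -/
theorem closes (hZ : DefectZeroTorsionAutomorphy) (hP : PositiveDefectTorsionAutomorphy) (hFL : FiniteLevelNormalForm) (hF : TorsionAvatarFrame) :
    _root_.Langlands := by
  refine hF ?_
  intro K _ _ n hcpt hn ι ρ hirr hins hnl hgeo hreg hlvl hav
  have hl := hFL K n ρ hav
  by_cases hd : (n = 2 ∧ NumberField.IsTotallyReal K)
  · exact hZ K n hcpt hn ι ρ hirr hins hnl hgeo hreg hlvl hd hl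
  · exact hP K n hcpt hn ι ρ hirr hins hnl hgeo hreg hlvl hd hl

/-- `closes` with FL discharged by the engine (three binders: TZ → TP → FRAME⁵ → Langlands) — the glue once this file is in the tree. -/
theorem closes_engine (hZ : DefectZeroTorsionAutomorphy) (hP : PositiveDefectTorsionAutomorphy) (hF : TorsionAvatarFrame) : _root_.Langlands :=
  closes hZ hP finiteLevelNormalForm_holds hF

/-- `closes` over the HOST route's binders: TA replaced by its two cells (four binders TZ → TP → AL → FRAME⁗ → Langlands). -/
theorem closes_host (hZ : DefectZeroTorsionAutomorphy) (hP : PositiveDefectTorsionAutomorphy) (hA : TorsionAvatarReduction.AvatarlessResidueAutomorphy)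
    (hF : TorsionAvatarReduction.RegularResidueFrame) : _root_.Langlands :=
  TorsionAvatarReduction.closes (ta_of_cells hZ hP) hA hF

/-- `closes` over the GRAND-HOST route-Langlands-RegularAvatarReduction (five binders; REG = TA ∧ AL = (TZ ∧ TP) ∧ AL). -/
theorem closes_grandhost (hZ : DefectZeroTorsionAutomorphy) (hP : PositiveDefectTorsionAutomorphy) (hA : TorsionAvatarReduction.AvatarlessResidueAutomorphy)
    (hN : RegularAvatarReduction.NoRegularAvatarAutomorphy) (hF : RegularAvatarReduction.NonLiftableResidueFrame) : _root_.Langlands :=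
  Torsion.closes (torsionAvatarAutomorphy_route_iff_twin.mp (ta_of_cells hZ hP)) (avatarlessResidueAutomorphy_route_iff_twin.mp hA) hN hF

/-- `closes` over the GREAT-GRAND-HOST route-Langlands-NonLiftableResidueReduction (six binders). -/
theorem closes_greatgrandhost (hL : NonLiftableResidueReduction.LiftableResidueAutomorphy) (hZ : DefectZeroTorsionAutomorphy)
    (hP : PositiveDefectTorsionAutomorphy) (hA : TorsionAvatarReduction.AvatarlessResidueAutomorphy) (hN : RegularAvatarReduction.NoRegularAvatarAutomorphy)
    (hF : NonLiftableResidueReduction.InsolubleResidueFrame) : _root_.Langlands :=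
  Torsion.closes_host hL (torsionAvatarAutomorphy_route_iff_twin.mp (ta_of_cells hZ hP)) (avatarlessResidueAutomorphy_route_iff_twin.mp hA) hN hF

end Summit.Langlands.Langlands.Theorems.LevelOneDyadic.FiniteLevel
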